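import Literature.Analysis.FluidPDE.KochTataruPointwise
import Literature.Analysis.FluidPDE.WeakGradientIBP
import Literature.Analysis.FluidPDE.WholeSpaceIBP
import Literature.Analysis.FluidPDE.HelmholtzAnnihilator
import Literature.Analysis.UnboundedOperators.HeatFlowCalculus
import HarnessLib

/-!
# The Oseen–Koch–Tataru kernel against test fields: adjoint identity, divergence freeness, tested `B(u, v)`

Analysis/FluidPDE proof companion of `Literature/Analysis/FluidPDE/KochTataru.lean` (the
decomposition of the named fact `Literature.Analysis.FluidPDE.koch_tataru`, **ns.S15**, Koch–Tataru,
Adv. Math. 157 (2001), Theorem 2, into (L1), (L2), (T1)–(T4)). It is the first layer of the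
discharge of **(T3)** `isKochTataruSolution_of_integral` ("a solution of the integral equation (11)
in `X` is a solution in Koch–Tataru's class": integral ⇒ very weak, Lemarié-Rieusset 2016,
Thm. 6.1, (6.12) ⇒ (6.11)), namely everything in (T3) that concerns the **bilinear term tested
against test fields**; the datum term, the `BMO⁻¹` slices and the assembly are the next files.
Everything here is **proved**:

* `§ Structure`: the gradient structure of the kernel (Koch–Tataru 2001, §2, (5)–(8)). With
  `heatKernelD2 s a b = D_aD_bG_s` and the third-derivative integrand
  `oseenIntegrand s z a b = Θ_s(z)[a,b] = ∇_z(D_aD_bG_s)(z)` (`fderiv_fderiv_heatKernel_apply_eq_heatKernelD2`,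
  `fderiv_heatKernelD2_apply`, `gradient_heatKernelD2`: product rule on the Gaussian),
  `oseenKernel_eq_fderiv_smul_add_integral`: **`K(σ,z)[a,b] = (D_aG_σ)(z) b + ∫_σ^∞ Θ_s(z)[a,b] ds`**
  for `σ > 0` (the Gaussian weights `A`, `B` of `KochTataru.lean` are the half-line moments of
  the two scalar coefficients of `Θ`);
* `§ Decomposition`: `‖Θ_s(z)[a,b]‖ ≤ C s^{-(d+3)/2}‖a‖‖b‖` (`exists_norm_oseenIntegrand_le`, Gaussian
  moments `G_s‖z‖ᵏ ≤ C s^{(k-d)/2}` from `exists_heatKernel_le_rpow`), joint measurability, and the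
  absolute convergence of `∫_σ^∞ Θ_s ds`;
* `§ IBP`, `§ LaplacianDecay`: whole-space integration by parts against shifted `C¹` kernels
  (`integral_fderiv_comp_sub_mul`, from Mathlib's `integral_mul_fderiv_eq_neg_fderiv_mul_of_integrable`;
  gradients against divergence-free fields and against gradients, from the tree's
  `integral_inner_gradient_eq_neg_integral_mul_divergence`), the decay
  `‖Δe^{sΔ}g(x)‖ ≤ C s^{-(d/2+1)}‖g‖₁` and **the heat flow from infinity**
  `∫_σ^∞ Δe^{sΔ}g(x) ds = -e^{σΔ}g(x)` (`integral_Ioi_laplacian_heatExtension`, positive dimension);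
* `§ Pairing`: the two kernel identities,
  **the adjoint identity** `integral_inner_oseenKernel_comp_sub_of_isDivFree`:
  `∫ ⟪K(σ, x-y)[a,b], φ(x)⟫ dx = -⟪b, D(e^{σΔ}φ)(y) a⟫` for divergence-free test fields `φ`
  (`Π` is the identity on them: the projector part `∫_σ^∞∇(D_aD_bG_s)` pairs to zero, the heat part
  integrates by parts once), and **divergence freeness** `integral_inner_oseenKernel_comp_sub_gradient`:
  `∫ ⟪K(σ, x-y)[a,b], ∇ψ(x)⟫ dx = 0` (heat part `-e^{σΔ}D_aD_bψ(y)`; projector part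
  `-∫_σ^∞ Δe^{sΔ}D_aD_bψ(y) ds = +e^{σΔ}D_aD_bψ(y)` by three integrations by parts, `∂Δ = Δ∂`, and the
  heat flow from infinity);
* `§ Bilinear`: the consequences for `B(u,v) = kochTataruBilinear u v` of fields with finite
  Koch–Tataru norms, by Fubini over `E × ((0,t) × E)` under the majorant of
  `KochTataruPointwise.lean` (`integral_inner_kochTataruBilinear_eq_setIntegral`):
  `integral_inner_kochTataruBilinear_of_isDivFree`
  (**`∫⟪B(u,v)(t), φ⟫ = -∫₀ᵗ∫⟪v, D(e^{(t-s)Δ}φ)(u)⟫`**, with absolute convergence of the right side),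
  its duality form `integral_inner_kochTataruBilinear_eq_neg_intervalIntegral`
  (`= -∫₀ᵗ∫⟪u(τ), (u(τ)·∇)e^{(t-τ)Δ}φ⟫ dτ`, the nonlinear term of `Fluid.IsMildNSSolutionFrom 1 0`),
  and `isWeaklyDivFree_kochTataruBilinear` (**every slice `B(u,v)(t)` is weakly divergence free**);
  slice measurability and boundedness (`stronglyMeasurable_kochTataruBilinear_slice`,
  `exists_norm_kochTataruBilinear_le`, `integrable_inner_kochTataruBilinear`).

## Mathlib / tree search

Tree: `KochTataru.lean` (kernel, weights, `B`), `KochTataruKernel.lean` (`exists_heatKernel_le_rpow`,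
`exists_oseenWeightA/B_le`, `measurable_heatKernel_uncurry`, (14)), `KochTataruPointwise.lean`
(majorant, `integrable_oseenKernel_duhamel`, `stronglyMeasurable_uncurry_kochTataruBilinear`),
`KochTataruFixedPoint.lean` (`kochTataruBilinear_congr_ae`), `HeatFlowCalculus` /
`HeatKernelHeatEquation` / `HeatKernelGradient` (`fderiv_heatKernel_apply_eq_mul_inner`,
`heatKernel_neg`, `fderiv_heatExtension_apply_of_hasCompactSupport`,
`laplacian_heatExtension_of_hasCompactSupport`, `heatExtension_sub_eq_integral_laplacian`,
`tendsto_enorm_heatExtension_atTop`, `laplacian_heatExtension_eq_integral`), `WholeSpaceIBP`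
(`integral_inner_gradient_eq_neg_integral_mul_divergence`, `divergence_gradient`,
`continuous_gradient_of_contDiff`), `WeakGradientIBP` (`inner_gradient_eq_fderiv_apply`,
`IsTestFunctionOn.fderiv_apply_const`, `fderiv_inner_const_left_apply`), `HelmholtzAnnihilator`
(`fderiv_fderiv_apply_comm`, `fderiv_laplacian_apply`). `OseenHeat.lean` realises `e^{τΔ}P∇·` through
the heat flow of the data (no kernel) and has no pairing identities. **Overlap, deliberately
re-derived:** the accepted sibling `KochTataruKernelFourier.lean` (Fourier symbol of the kernel)
already proves the Gaussian derivative formulas `fderiv_fderiv_heatKernel_apply` (= the formula of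
`heatKernelD2`, here `fderiv_fderiv_heatKernel_apply_eq_heatKernelD2`),
`hasFDerivAt_fderiv_fderiv_heatKernel_apply` (= `hasFDerivAt_heatKernelD2`),
`fderiv_fderiv_fderiv_heatKernel_apply` (= `fderiv_heatKernelD2_apply`, i.e. `⟪Θ, w⟫`) and
`inner_oseenKernel_eq` (the scalar-tested form of `oseenKernel_eq_fderiv_smul_add_integral`), and
`FunctionSpaces.contDiff_heatKernel'` (`GaussianSchwartz.lean`) is `contDiff_heatKernel_space`; the
short derivative block of `§ Structure` is re-derived here (product rule, a few lines each) so as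
not to import the Fourier-side files (`GaussianSchwartz`, `Real.fourierIntegral`) into the
physical-space pairing theory — a librarian consolidation candidate. The pairing identities, the
heat flow from infinity and everything in `§ Bilinear` exist nowhere else
(`lean search 'oseenKernel_comp_sub|integral_Ioi_laplacian|isWeaklyDivFree_kochTataruBilinear'`).
Mathlib: `integral_mul_fderiv_eq_neg_fderiv_mul_of_integrable`, `fderiv_comp_sub`,
`HasFDerivAt.mul`, `integral_integral_swap`, `Integrable.integral_prod_left/right`,
`lintegral_prod`, `intervalIntegral_tendsto_integral_Ioi`, `Measure.prod_restrict`.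

## References

* H. Koch, D. Tataru, *Well-posedness for the Navier–Stokes equations*, Adv. Math. 157 (2001)
  22–35, §2 ((5)–(8): `Π`, the kernels of `ΠS(t)` and `Π∇S(t)`), §3 ((11), (12)). Bib key
  `KochTataruAdvMath2001` (held: doi:10.1006/aima.2000.1937).
* P. G. Lemarié-Rieusset, *The Navier–Stokes problem in the 21st century*, CRC Press 2016
  (held), Ch. 6, Thm. 6.1 ((6.12) ⇒ (6.11): a solution of the integral equation with the Oseen
  tensor is a very weak solution), §4.5 (the Oseen tensor). Bib key `LemarieRieusset2016`.
-/

noncomputable section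

open MeasureTheory Set Function Filter Topology Metric Real TopologicalSpace
open scoped ENNReal NNReal RealInnerProductSpace Laplacian

namespace Literature.Analysis.FluidPDE

variable {E : Type*} [NormedAddCommGroup E] [InnerProductSpace ℝ E]

/-! ## The gradient structure of the kernel: `D_a D_b G_s` and `Θ_s = ∇ D_a D_b G_s` -/

section Structure

/-- The **mixed second derivative of the Gauss–Weierstrass kernel**,
`D_a D_b G_s (z) = G_s(z) (⟪z,a⟫⟪z,b⟫/(4s²) - ⟪a,b⟫/(2s))` (Koch–Tataru 2001, §2, (6) and (8): the
kernel of `Π S(t)` is `δ_{jl} G - ∂_j∂_l Δ⁻¹G`, built from the second derivatives of the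
Gaussian; the Gaussian formula itself is not printed in the paper and is proved below,
`fderiv_fderiv_heatKernel_apply_eq_heatKernelD2`). [cite: KochTataruAdvMath2001, §2 (6) and (8)] -/
def heatKernelD2 (s : ℝ) (a b z : E) : ℝ :=
  UnboundedOperators.heatKernel s z * (⟪z, a⟫ * ⟪z, b⟫ / (4 * s ^ 2) - ⟪a, b⟫ / (2 * s))

/-- The **third-derivative integrand of the Oseen–Koch–Tataru kernel**,
`Θ_s(z)[a, b] = ∇_z (D_a D_b G_s)(z)
  = G_s(z) ((⟪z,a⟫ b + ⟪a,b⟫ z + ⟪z,b⟫ a)/(4s²) - ⟪z,a⟫⟪z,b⟫ z/(8s³))`,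
whose half-line integral `∫_σ^∞ Θ_s ds = -∇ D_a D_b Δ⁻¹G_σ` is the projector part of
`K(σ, z)[a, b] = oseenKernel σ z a b` (Koch–Tataru 2001, §2, (8): the kernel of `Π∇S(t)`). [cite: KochTataruAdvMath2001, §2 (8)] -/
def oseenIntegrand (s : ℝ) (z a b : E) : E :=
  (UnboundedOperators.heatKernel s z / (4 * s ^ 2)) • (⟪z, a⟫ • b + ⟪a, b⟫ • z + ⟪z, b⟫ • a) -
    (UnboundedOperators.heatKernel s z / (8 * s ^ 3) * (⟪z, a⟫ * ⟪z, b⟫)) • z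

/-- `Θ_s(0)[a, b] = 0`. [folklore] -/
@[simp]
theorem oseenIntegrand_zero (s : ℝ) (a b : E) : oseenIntegrand s (0 : E) a b = 0 := by
  simp [oseenIntegrand]

/-- The heat kernel is smooth in space (for every fixed time, junk times included). [folklore] -/
theorem contDiff_heatKernel_space {n : WithTop ℕ∞} (t : ℝ) :
    ContDiff ℝ n (UnboundedOperators.heatKernel (E := E) t) := by
  unfold UnboundedOperators.heatKernel
  exact contDiff_const.mul (Real.contDiff_exp.comp
    (((contDiff_norm_sq ℝ).neg).div_const _))

/-- **The first derivative of the Gaussian** as a function: `D_b G_s = -(G_s/(2s)) ⟪·, b⟫`.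
[folklore] -/
theorem fderiv_heatKernel_apply_eq (s : ℝ) (b : E) :
    (fun w : E => fderiv ℝ (UnboundedOperators.heatKernel s) w b) =
      fun w => -(UnboundedOperators.heatKernel s w / (2 * s)) * ⟪w, b⟫ :=
  funext fun w => UnboundedOperators.fderiv_heatKernel_apply_eq_mul_inner s w b

/-- `w ↦ D_b G_s(w)` is smooth. [folklore] -/
theorem contDiff_fderiv_heatKernel_apply {n : WithTop ℕ∞} (s : ℝ) (b : E) :
    ContDiff ℝ n (fun w : E => fderiv ℝ (UnboundedOperators.heatKernel s) w b) := by
  rw [fderiv_heatKernel_apply_eq]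
  exact ((contDiff_heatKernel_space s).div_const _).neg.mul (contDiff_id.inner ℝ contDiff_const)

/-- **The second derivatives of the Gaussian**: `D_a (D_b G_s)(z) = heatKernelD2 s a b z`
(product rule on `w ↦ D_b G_s(w) = -(G_s(w)/(2s)) ⟪w, b⟫`; formula not printed in Koch–Tataru, who
only use the resulting kernel (8)). [cite: KochTataruAdvMath2001, §2 (6) and (8)] -/
theorem fderiv_fderiv_heatKernel_apply_eq_heatKernelD2 (s : ℝ) (a b z : E) :
    fderiv ℝ (fun w : E => fderiv ℝ (UnboundedOperators.heatKernel s) w b) z a =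
      heatKernelD2 s a b z := by
  rw [fderiv_heatKernel_apply_eq]
  have hG := UnboundedOperators.hasFDerivAt_heatKernel s z
  have hc : HasFDerivAt (fun w : E => -(UnboundedOperators.heatKernel s w / (2 * s)))
      ((-(1 / (2 * s))) • (-(UnboundedOperators.heatKernel s z / (2 * s)) • innerSL ℝ z)) z := by
    refine (hG.const_smul (-(1 / (2 * s)))).congr_of_eventuallyEq
      (Eventually.of_forall fun w => ?_)
    simp only [Pi.smul_apply, smul_eq_mul]
    ring
  have hd : HasFDerivAt (fun w : E => ⟪w, b⟫) (innerSL ℝ b) z := by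
    refine ((innerSL ℝ b).hasFDerivAt (x := z)).congr_of_eventuallyEq
      (Eventually.of_forall fun w => ?_)
    simp [real_inner_comm]
  rw [show (fun w : E => -(UnboundedOperators.heatKernel s w / (2 * s)) * ⟪w, b⟫) =
      (fun w : E => -(UnboundedOperators.heatKernel s w / (2 * s))) * fun w : E => ⟪w, b⟫ from rfl,
    (hc.mul hd).fderiv]
  simp only [heatKernelD2, add_apply, smul_apply, innerSL_apply_apply, smul_eq_mul,
    real_inner_comm a]
  ring

/-- `heatKernelD2` written through the second derivative, as functions. [folklore] -/
theorem heatKernelD2_eq (s : ℝ) (a b : E) :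
    heatKernelD2 s a b = fun z => fderiv ℝ (fun w : E => fderiv ℝ (UnboundedOperators.heatKernel s) w b) z a :=
  funext fun z => (fderiv_fderiv_heatKernel_apply_eq_heatKernelD2 s a b z).symm

/-- `heatKernelD2 s a b` is smooth. [folklore] -/
theorem contDiff_heatKernelD2 {n : WithTop ℕ∞} (s : ℝ) (a b : E) :
    ContDiff ℝ n (heatKernelD2 s a b) := by
  unfold heatKernelD2
  refine (contDiff_heatKernel_space s).mul ?_
  exact (((contDiff_id.inner ℝ contDiff_const).mul (contDiff_id.inner ℝ contDiff_const)).div_const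
    _).sub contDiff_const

/-- **The third derivatives of the Gaussian**: the derivative of `D_a D_b G_s` at `z` is the
functional `w ↦ ⟪Θ_s(z)[a, b], w⟫`, i.e. `∇ (D_a D_b G_s) = Θ_s[a, b]` (Koch–Tataru 2001, §2,
(8)). [cite: KochTataruAdvMath2001, §2 (8)] -/
theorem hasFDerivAt_heatKernelD2 (s : ℝ) (a b z : E) :
    HasFDerivAt (heatKernelD2 s a b)
      (UnboundedOperators.heatKernel s z •
          ((1 / (4 * s ^ 2)) • (⟪z, b⟫ • innerSL ℝ a + ⟪z, a⟫ • innerSL ℝ b)) +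
        (⟪z, a⟫ * ⟪z, b⟫ / (4 * s ^ 2) - ⟪a, b⟫ / (2 * s)) •
          (-(UnboundedOperators.heatKernel s z / (2 * s)) • innerSL ℝ z))
      z := by
  unfold heatKernelD2
  have hG := UnboundedOperators.hasFDerivAt_heatKernel s z
  have ha : HasFDerivAt (fun w : E => ⟪w, a⟫) (innerSL ℝ a) z := by
    refine ((innerSL ℝ a).hasFDerivAt (x := z)).congr_of_eventuallyEq
      (Eventually.of_forall fun w => ?_)
    simp [real_inner_comm]
  have hb : HasFDerivAt (fun w : E => ⟪w, b⟫) (innerSL ℝ b) z := by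
    refine ((innerSL ℝ b).hasFDerivAt (x := z)).congr_of_eventuallyEq
      (Eventually.of_forall fun w => ?_)
    simp [real_inner_comm]
  have hq : HasFDerivAt (fun w : E => ⟪w, a⟫ * ⟪w, b⟫ / (4 * s ^ 2) - ⟪a, b⟫ / (2 * s))
      ((1 / (4 * s ^ 2)) • (⟪z, b⟫ • innerSL ℝ a + ⟪z, a⟫ • innerSL ℝ b)) z := by
    have h1 := ((ha.mul hb).mul_const (1 / (4 * s ^ 2))).sub_const (⟪a, b⟫ / (2 * s))
    have hfun : (fun w : E => ⟪w, a⟫ * ⟪w, b⟫ / (4 * s ^ 2) - ⟪a, b⟫ / (2 * s)) =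
        fun w => ((fun w : E => ⟪w, a⟫) * fun w : E => ⟪w, b⟫) w * (1 / (4 * s ^ 2)) -
          ⟪a, b⟫ / (2 * s) := by
      funext w
      simp only [Pi.mul_apply]
      ring
    rw [hfun]
    refine h1.congr_fderiv ?_
    ext w
    simp only [smul_apply, add_apply, innerSL_apply_apply, smul_eq_mul]
    ring
  exact hG.mul hq

/-- `D_w (D_a D_b G_s)(z) = ⟪Θ_s(z)[a, b], w⟫`. [cite: KochTataruAdvMath2001, §2 (8)] -/
theorem fderiv_heatKernelD2_apply (s : ℝ) (a b z w : E) :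
    fderiv ℝ (heatKernelD2 s a b) z w = ⟪oseenIntegrand s z a b, w⟫ := by
  rw [(hasFDerivAt_heatKernelD2 s a b z).fderiv]
  simp only [oseenIntegrand, add_apply, smul_apply, innerSL_apply_apply, smul_eq_mul,
    inner_sub_left, inner_add_left, real_inner_smul_left]
  ring

/-- The gradient form: `∇(D_a D_b G_s)(z) = Θ_s(z)[a, b]`. [cite: KochTataruAdvMath2001, §2 (8)] -/
theorem gradient_heatKernelD2 [CompleteSpace E] (s : ℝ) (a b z : E) :
    gradient (heatKernelD2 s a b) z = oseenIntegrand s z a b := by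
  apply ext_inner_right ℝ
  intro w
  rw [real_inner_comm, inner_gradient_eq_fderiv_apply, fderiv_heatKernelD2_apply]

end Structure

/-! ## Decomposition of the kernel, size and measurability of `Θ` -/

section Decomposition

variable [FiniteDimensional ℝ E] [MeasurableSpace E] [BorelSpace E]

omit [MeasurableSpace E] [BorelSpace E] in
/-- **The gradient structure of the Oseen–Koch–Tataru kernel** (Koch–Tataru 2001, §2, (5)–(8):
`K = D_a[(δ G_σ - ∇∇Δ⁻¹G_σ) b]` with `Δ⁻¹G_σ = -∫_σ^∞ G_s ds`): for `σ > 0`,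
`K(σ, z)[a, b] = (D_a G_σ)(z) b + ∫_σ^∞ Θ_s(z)[a, b] ds`, the half-line integral being absolutely
convergent (the Gaussian moments `∫_σ^∞ G_s/(4s²)`, `∫_σ^∞ G_s/(8s³)` of `oseenWeightA/B`). [cite: KochTataruAdvMath2001, §2 (5)–(8)] -/
theorem oseenKernel_eq_fderiv_smul_add_integral {σ : ℝ} (hσ : 0 < σ) (z a b : E) :
    oseenKernel σ z a b =
      (fderiv ℝ (UnboundedOperators.heatKernel σ) z a) • b + ∫ s in Ioi σ, oseenIntegrand s z a b := by
  obtain ⟨CA, hCA, hA⟩ := exists_oseenWeightA_le (E := E)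
  obtain ⟨CB, hCB, hB⟩ := exists_oseenWeightB_le (E := E)
  obtain ⟨hiA, -, -⟩ := hA hσ z
  obtain ⟨hiB, -, -⟩ := hB hσ z
  set V : E := ⟪z, a⟫ • b + ⟪a, b⟫ • z + ⟪z, b⟫ • a with hV
  set c : ℝ := ⟪z, a⟫ * ⟪z, b⟫ with hc
  have h1 : ∫ s in Ioi σ, oseenIntegrand s z a b =
      (∫ s in Ioi σ, UnboundedOperators.heatKernel s z / (4 * s ^ 2)) • V -
        (∫ s in Ioi σ, UnboundedOperators.heatKernel s z / (8 * s ^ 3) * c) • z := by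
    unfold oseenIntegrand
    rw [integral_sub (hiA.smul_const V) ((hiB.mul_const c).smul_const z), integral_smul_const,
      integral_smul_const]
  rw [h1, integral_mul_const, oseenKernel, oseenWeightA, oseenWeightB,
    UnboundedOperators.fderiv_heatKernel_apply_eq_mul_inner]
  have : -(UnboundedOperators.heatKernel σ z / (2 * σ)) * ⟪z, a⟫ =
      -(⟪z, a⟫ / (2 * σ) * UnboundedOperators.heatKernel σ z) := by ring
  rw [this, hV, hc, add_sub_assoc]

omit [FiniteDimensional ℝ E] [MeasurableSpace E] [BorelSpace E] in
/-- **Size of `Θ` in the tensor slots**: `‖Θ_s(z)[a, b]‖ ≤ (3 G_s(z)‖z‖/(4s²) + G_s(z)‖z‖³/(8|s|³)) ‖a‖ ‖b‖`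
(Cauchy–Schwarz termwise; Koch–Tataru 2001, §2, (8)). [cite: KochTataruAdvMath2001, §2 (8)] -/
theorem norm_oseenIntegrand_le (s : ℝ) (z a b : E) :
    ‖oseenIntegrand s z a b‖ ≤
      (3 * (|UnboundedOperators.heatKernel s z| / (4 * s ^ 2)) * ‖z‖ +
          |UnboundedOperators.heatKernel s z| / (8 * |s| ^ 3) * ‖z‖ ^ 3) * ‖a‖ * ‖b‖ := by
  have hza : |⟪z, a⟫| ≤ ‖z‖ * ‖a‖ := abs_real_inner_le_norm z a
  have hzb : |⟪z, b⟫| ≤ ‖z‖ * ‖b‖ := abs_real_inner_le_norm z b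
  have hab : |⟪a, b⟫| ≤ ‖a‖ * ‖b‖ := abs_real_inner_le_norm a b
  set G := UnboundedOperators.heatKernel s z with hG
  have hV : ‖⟪z, a⟫ • b + ⟪a, b⟫ • z + ⟪z, b⟫ • a‖ ≤ 3 * (‖z‖ * ‖a‖ * ‖b‖) := by
    calc ‖⟪z, a⟫ • b + ⟪a, b⟫ • z + ⟪z, b⟫ • a‖
        ≤ ‖⟪z, a⟫ • b‖ + ‖⟪a, b⟫ • z‖ + ‖⟪z, b⟫ • a‖ := norm_add₃_le
      _ = |⟪z, a⟫| * ‖b‖ + |⟪a, b⟫| * ‖z‖ + |⟪z, b⟫| * ‖a‖ := by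
          simp only [norm_smul, Real.norm_eq_abs]
      _ ≤ ‖z‖ * ‖a‖ * ‖b‖ + ‖a‖ * ‖b‖ * ‖z‖ + ‖z‖ * ‖b‖ * ‖a‖ := by gcongr
      _ = 3 * (‖z‖ * ‖a‖ * ‖b‖) := by ring
  have h1 : ‖(G / (4 * s ^ 2)) • (⟪z, a⟫ • b + ⟪a, b⟫ • z + ⟪z, b⟫ • a)‖ ≤
      3 * (|G| / (4 * s ^ 2)) * ‖z‖ * ‖a‖ * ‖b‖ := by
    rw [norm_smul, Real.norm_eq_abs, abs_div, abs_mul, abs_of_nonneg (by norm_num : (0 : ℝ) ≤ 4),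
      abs_pow, sq_abs]
    calc |G| / (4 * s ^ 2) * ‖⟪z, a⟫ • b + ⟪a, b⟫ • z + ⟪z, b⟫ • a‖
        ≤ |G| / (4 * s ^ 2) * (3 * (‖z‖ * ‖a‖ * ‖b‖)) := by gcongr
      _ = 3 * (|G| / (4 * s ^ 2)) * ‖z‖ * ‖a‖ * ‖b‖ := by ring
  have h2 : ‖(G / (8 * s ^ 3) * (⟪z, a⟫ * ⟪z, b⟫)) • z‖ ≤
      |G| / (8 * |s| ^ 3) * ‖z‖ ^ 3 * ‖a‖ * ‖b‖ := by
    rw [norm_smul, Real.norm_eq_abs, abs_mul, abs_mul, abs_div, abs_mul,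
      abs_of_nonneg (by norm_num : (0 : ℝ) ≤ 8), abs_pow]
    calc |G| / (8 * |s| ^ 3) * (|⟪z, a⟫| * |⟪z, b⟫|) * ‖z‖
        ≤ |G| / (8 * |s| ^ 3) * (‖z‖ * ‖a‖ * (‖z‖ * ‖b‖)) * ‖z‖ := by gcongr
      _ = |G| / (8 * |s| ^ 3) * ‖z‖ ^ 3 * ‖a‖ * ‖b‖ := by ring
  calc ‖oseenIntegrand s z a b‖
      ≤ ‖(G / (4 * s ^ 2)) • (⟪z, a⟫ • b + ⟪a, b⟫ • z + ⟪z, b⟫ • a)‖ +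
          ‖(G / (8 * s ^ 3) * (⟪z, a⟫ * ⟪z, b⟫)) • z‖ := norm_sub_le _ _
    _ ≤ 3 * (|G| / (4 * s ^ 2)) * ‖z‖ * ‖a‖ * ‖b‖ + |G| / (8 * |s| ^ 3) * ‖z‖ ^ 3 * ‖a‖ * ‖b‖ :=
        add_le_add h1 h2
    _ = _ := by ring

omit [FiniteDimensional ℝ E] [MeasurableSpace E] [BorelSpace E] in
/-- **Uniform decay of `Θ` in time**: there is `C = C(E)` with
`‖Θ_s(z)[a, b]‖ ≤ C s^{-(d+3)/2} ‖a‖ ‖b‖` for all `s > 0` and `z, a, b` (the Gaussian moments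
`G_s(z)‖z‖ᵏ ≤ C_k s^{(k-d)/2}`, from `exists_heatKernel_le_rpow`). In particular `s ↦ Θ_s(z)[a, b]`
is absolutely integrable on every half-line `(σ, ∞)`, `σ > 0` (Koch–Tataru 2001, §2, (8)). [cite: KochTataruAdvMath2001, §2 (8)] -/
theorem exists_norm_oseenIntegrand_le :
    ∃ C : ℝ, 0 < C ∧ ∀ {s : ℝ}, 0 < s → ∀ z a b : E,
      ‖oseenIntegrand s z a b‖ ≤ C * s ^ (-(((Module.finrank ℝ E : ℝ) + 3) / 2)) * ‖a‖ * ‖b‖ := by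
  set d : ℝ := (Module.finrank ℝ E : ℝ) with hd
  obtain ⟨C₁, hC₁, hG₁⟩ := exists_heatKernel_le_rpow (E := E) (1 / 2)
  obtain ⟨C₃, hC₃, hG₃⟩ := exists_heatKernel_le_rpow (E := E) (3 / 2)
  refine ⟨3 * C₁ / 4 + C₃ / 8, by positivity, fun {s} hs z a b => ?_⟩
  set ρ : ℝ := s + ‖z‖ ^ 2 with hρ
  have hρ0 : 0 < ρ := by positivity
  have hzρ : ‖z‖ ≤ ρ ^ (1 / 2 : ℝ) := norm_le_add_sq_rpow_half hs.le z
  have hGpos : 0 < UnboundedOperators.heatKernel s z := UnboundedOperators.heatKernel_pos hs z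
  -- the two Gaussian moments
  have hm1 : UnboundedOperators.heatKernel s z * ‖z‖ ≤ C₁ * s ^ (1 / 2 - d / 2) := by
    calc UnboundedOperators.heatKernel s z * ‖z‖
        ≤ (C₁ * s ^ (1 / 2 - d / 2) * ρ ^ (-(1 / 2 : ℝ))) * ρ ^ (1 / 2 : ℝ) :=
          mul_le_mul (hG₁ hs z) hzρ (norm_nonneg _) (by positivity)
      _ = C₁ * s ^ (1 / 2 - d / 2) * (ρ ^ (-(1 / 2 : ℝ)) * ρ ^ (1 / 2 : ℝ)) := by ring
      _ = C₁ * s ^ (1 / 2 - d / 2) := by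
          rw [← Real.rpow_add hρ0, neg_add_cancel, Real.rpow_zero, mul_one]
  have hm3 : UnboundedOperators.heatKernel s z * ‖z‖ ^ 3 ≤ C₃ * s ^ (3 / 2 - d / 2) := by
    have hz3 : ‖z‖ ^ 3 ≤ (ρ ^ (1 / 2 : ℝ)) ^ 3 := by gcongr
    have hρ3 : (ρ ^ (1 / 2 : ℝ)) ^ 3 = ρ ^ (3 / 2 : ℝ) := by
      rw [← Real.rpow_natCast, ← Real.rpow_mul hρ0.le]; norm_num
    calc UnboundedOperators.heatKernel s z * ‖z‖ ^ 3
        ≤ (C₃ * s ^ (3 / 2 - d / 2) * ρ ^ (-(3 / 2 : ℝ))) * (ρ ^ (1 / 2 : ℝ)) ^ 3 :=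
          mul_le_mul (hG₃ hs z) hz3 (by positivity) (by positivity)
      _ = C₃ * s ^ (3 / 2 - d / 2) * (ρ ^ (-(3 / 2 : ℝ)) * ρ ^ (3 / 2 : ℝ)) := by rw [hρ3]; ring
      _ = C₃ * s ^ (3 / 2 - d / 2) := by
          rw [← Real.rpow_add hρ0, neg_add_cancel, Real.rpow_zero, mul_one]
  -- the powers of `s`
  have hp1 : s ^ (1 / 2 - d / 2) / s ^ 2 = s ^ (-((d + 3) / 2)) := by
    rw [← Real.rpow_natCast, ← Real.rpow_sub hs]
    congr 1; push_cast; ring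
  have hp3 : s ^ (3 / 2 - d / 2) / s ^ 3 = s ^ (-((d + 3) / 2)) := by
    rw [← Real.rpow_natCast, ← Real.rpow_sub hs]
    congr 1; push_cast; ring
  have hmain := norm_oseenIntegrand_le s z a b
  rw [abs_of_pos hGpos, abs_of_pos hs] at hmain
  have hT1 : 3 * (UnboundedOperators.heatKernel s z / (4 * s ^ 2)) * ‖z‖ ≤
      3 * C₁ / 4 * s ^ (-((d + 3) / 2)) := by
    have hs2 : 0 < s ^ 2 := by positivity
    calc 3 * (UnboundedOperators.heatKernel s z / (4 * s ^ 2)) * ‖z‖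
        = 3 / 4 * ((UnboundedOperators.heatKernel s z * ‖z‖) / s ^ 2) := by field_simp
      _ ≤ 3 / 4 * ((C₁ * s ^ (1 / 2 - d / 2)) / s ^ 2) := by gcongr
      _ = 3 * C₁ / 4 * (s ^ (1 / 2 - d / 2) / s ^ 2) := by ring
      _ = 3 * C₁ / 4 * s ^ (-((d + 3) / 2)) := by rw [hp1]
  have hT3 : UnboundedOperators.heatKernel s z / (8 * s ^ 3) * ‖z‖ ^ 3 ≤
      C₃ / 8 * s ^ (-((d + 3) / 2)) := by
    have hs3 : 0 < s ^ 3 := by positivity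
    calc UnboundedOperators.heatKernel s z / (8 * s ^ 3) * ‖z‖ ^ 3
        = 1 / 8 * ((UnboundedOperators.heatKernel s z * ‖z‖ ^ 3) / s ^ 3) := by field_simp
      _ ≤ 1 / 8 * ((C₃ * s ^ (3 / 2 - d / 2)) / s ^ 3) := by gcongr
      _ = C₃ / 8 * (s ^ (3 / 2 - d / 2) / s ^ 3) := by ring
      _ = C₃ / 8 * s ^ (-((d + 3) / 2)) := by rw [hp3]
  calc ‖oseenIntegrand s z a b‖
      ≤ (3 * (UnboundedOperators.heatKernel s z / (4 * s ^ 2)) * ‖z‖ +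
          UnboundedOperators.heatKernel s z / (8 * s ^ 3) * ‖z‖ ^ 3) * ‖a‖ * ‖b‖ := hmain
    _ ≤ (3 * C₁ / 4 * s ^ (-((d + 3) / 2)) + C₃ / 8 * s ^ (-((d + 3) / 2))) * ‖a‖ * ‖b‖ := by
        gcongr
    _ = (3 * C₁ / 4 + C₃ / 8) * s ^ (-((d + 3) / 2)) * ‖a‖ * ‖b‖ := by ring

/-- **`Θ` is jointly measurable** in `(s, z)` on all of `ℝ × E` (junk values at `s ≤ 0` included):
an algebraic expression in the measurable `G_s(z)` and inner products. [folklore] -/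
theorem measurable_oseenIntegrand (a b : E) :
    Measurable (fun p : ℝ × E => oseenIntegrand p.1 p.2 a b) := by
  have hG : Measurable (fun p : ℝ × E => UnboundedOperators.heatKernel p.1 p.2) :=
    measurable_heatKernel_uncurry
  have hs : Measurable (fun p : ℝ × E => p.1) := measurable_fst
  have hz : Measurable (fun p : ℝ × E => p.2) := measurable_snd
  have hza : Measurable (fun p : ℝ × E => ⟪p.2, a⟫) := hz.inner measurable_const
  have hzb : Measurable (fun p : ℝ × E => ⟪p.2, b⟫) := hz.inner measurable_const
  unfold oseenIntegrand
  refine Measurable.sub ?_ ?_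
  · exact (hG.div (measurable_const.mul (hs.pow_const 2))).smul
      (((hza.smul measurable_const).add (measurable_const.smul hz)).add (hzb.smul measurable_const))
  · exact ((hG.div (measurable_const.mul (hs.pow_const 3))).mul (hza.mul hzb)).smul hz

omit [FiniteDimensional ℝ E] [MeasurableSpace E] [BorelSpace E] in
/-- `Θ_s(·)[a, b]` is continuous in `z` for every `s`. [folklore] -/
theorem continuous_oseenIntegrand (s : ℝ) (a b : E) :
    Continuous (fun z : E => oseenIntegrand s z a b) := by
  have hG : Continuous (UnboundedOperators.heatKernel (E := E) s) :=
    UnboundedOperators.continuous_heatKernel s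
  unfold oseenIntegrand
  fun_prop

/-- **Absolute convergence of the half-line integral of `Θ`** on `(σ, ∞)`, `σ > 0`, with the bound
`∫_σ^∞ ‖Θ_s(z)[a,b]‖ ds ≤ (∫_σ^∞ C s^{-(d+3)/2} ds) ‖a‖ ‖b‖` uniform in `z`. [cite: KochTataruAdvMath2001, §2 (8)] -/
theorem exists_integrableOn_oseenIntegrand :
    ∃ M : ℝ → ℝ, (∀ {σ : ℝ}, 0 < σ → 0 ≤ M σ) ∧ ∀ {σ : ℝ}, 0 < σ → ∀ z a b : E,
      IntegrableOn (fun s => oseenIntegrand s z a b) (Ioi σ) ∧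
        ∫ s in Ioi σ, ‖oseenIntegrand s z a b‖ ≤ M σ * ‖a‖ * ‖b‖ := by
  classical
  obtain ⟨C, hC, hΘ⟩ := exists_norm_oseenIntegrand_le (E := E)
  set r : ℝ := -(((Module.finrank ℝ E : ℝ) + 3) / 2) with hr
  have hr1 : r < -1 := by
    rw [hr]
    have : (0 : ℝ) ≤ Module.finrank ℝ E := Nat.cast_nonneg _
    linarith
  refine ⟨fun σ => ∫ s in Ioi σ, C * s ^ r, fun {σ} hσ => ?_, fun {σ} hσ z a b => ?_⟩
  · exact setIntegral_nonneg measurableSet_Ioi fun s hs =>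
      mul_nonneg hC.le (Real.rpow_nonneg (hσ.trans hs).le _)
  have hpow : IntegrableOn (fun s : ℝ => C * s ^ r) (Ioi σ) :=
    (integrableOn_Ioi_rpow_of_lt hr1 hσ).const_mul C
  have hmeas : AEStronglyMeasurable (fun s => oseenIntegrand s z a b) (volume.restrict (Ioi σ)) :=
    ((measurable_oseenIntegrand a b).comp (measurable_id.prodMk measurable_const)).aestronglyMeasurable
  have hbound : ∀ s ∈ Ioi σ, ‖oseenIntegrand s z a b‖ ≤ C * s ^ r * (‖a‖ * ‖b‖) := fun s hs => by
    rw [← mul_assoc]; exact hΘ (hσ.trans hs) z a b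
  have hint : IntegrableOn (fun s => oseenIntegrand s z a b) (Ioi σ) :=
    (hpow.mul_const (‖a‖ * ‖b‖)).mono' hmeas
      ((ae_restrict_iff' measurableSet_Ioi).2 (Eventually.of_forall hbound))
  refine ⟨hint, ?_⟩
  calc ∫ s in Ioi σ, ‖oseenIntegrand s z a b‖ ≤ ∫ s in Ioi σ, C * s ^ r * (‖a‖ * ‖b‖) :=
        setIntegral_mono_on hint.norm (hpow.mul_const _) measurableSet_Ioi hbound
    _ = (∫ s in Ioi σ, C * s ^ r) * ‖a‖ * ‖b‖ := by rw [integral_mul_const, mul_assoc]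

end Decomposition

/-! ## Whole-space integration by parts against shifted kernels; the Laplacian of the heat flow -/

section IBP

variable [FiniteDimensional ℝ E] [MeasurableSpace E] [BorelSpace E]

/-- **Integration by parts against a shifted `C¹` kernel** (no boundary terms on the whole space,
the second factor being compactly supported): `∫ (D_v k)(x - y) f(x) dx = -∫ k(x - y) D_v f(x) dx`
for `k ∈ C¹(E)`, `f ∈ C¹_c(E)` (Evans, *PDE*, App. C.2, Thm. 2). [folklore] -/
theorem integral_fderiv_comp_sub_mul {k f : E → ℝ} (hk : ContDiff ℝ 1 k) (hf : ContDiff ℝ 1 f)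
    (hfc : HasCompactSupport f) (y v : E) :
    ∫ x, fderiv ℝ k (x - y) v * f x = -∫ x, k (x - y) * fderiv ℝ f x v := by
  set g : E → ℝ := fun x => k (x - y) with hg_def
  have hg : ContDiff ℝ 1 g := hk.comp (contDiff_id.sub contDiff_const)
  have hgd : ∀ x, fderiv ℝ g x = fderiv ℝ k (x - y) := fun x => fderiv_comp_sub y
  have hgc : Continuous g := hg.continuous
  have hgD : Continuous fun x => fderiv ℝ g x v := (hg.continuous_fderiv one_ne_zero).clm_apply
    continuous_const
  have hfD : Continuous fun x => fderiv ℝ f x v := (hf.continuous_fderiv one_ne_zero).clm_apply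
    continuous_const
  have i1 : Integrable (fun x => fderiv ℝ g x v * f x) :=
    (hgD.mul hf.continuous).integrable_of_hasCompactSupport hfc.mul_left
  have i2 : Integrable (fun x => g x * fderiv ℝ f x v) :=
    (hgc.mul hfD).integrable_of_hasCompactSupport (hfc.fderiv_apply (𝕜 := ℝ) v).mul_left
  have i3 : Integrable (fun x => g x * f x) :=
    (hgc.mul hf.continuous).integrable_of_hasCompactSupport hfc.mul_left
  have h := integral_mul_fderiv_eq_neg_fderiv_mul_of_integrable (μ := volume) i1 i2 i3
    (fun x _ => hg.differentiable one_ne_zero x) (fun x _ => hf.differentiable one_ne_zero x)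
  simp only [hgd] at h
  rw [h, neg_neg]

/-- **A shifted gradient annihilates compactly supported divergence-free fields**:
`∫ ⟪∇[p(· - y)](x), φ(x)⟫ dx = 0` for `p ∈ C¹(E)` and `φ ∈ C¹_c(E; E)` with `div φ = 0` (the
pressure drops out; Leray 1934, §6 (1.11)). [folklore] -/
theorem integral_inner_gradient_comp_sub_eq_zero {p : E → ℝ} (hp : ContDiff ℝ 1 p) {φ : E → E}
    (hφ : ContDiff ℝ 1 φ) (hφc : HasCompactSupport φ) (hdiv : VectorCalculus.IsDivFree φ) (y : E) :
    ∫ x, ⟪gradient (fun x => p (x - y)) x, φ x⟫ = 0 := by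
  have hpy : ContDiff ℝ 1 (fun x => p (x - y)) := hp.comp (contDiff_id.sub contDiff_const)
  rw [integral_inner_gradient_eq_neg_integral_mul_divergence hpy hφ hφc]
  simp [hdiv _]

/-- **A shifted gradient against a gradient**: `∫ ⟪∇[p(· - y)](x), ∇ψ(x)⟫ dx = -∫ p(x - y) Δψ(x) dx`
for `p ∈ C¹(E)`, `ψ ∈ C²_c(E)` (`div ∇ψ = Δψ`; Evans, *PDE*, App. C.2, Thm. 3 (Green)). [folklore] -/
theorem integral_inner_gradient_comp_sub_gradient {p : E → ℝ} (hp : ContDiff ℝ 1 p) {ψ : E → ℝ}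
    (hψ : ContDiff ℝ 2 ψ) (hψc : HasCompactSupport ψ) (y : E) :
    ∫ x, ⟪gradient (fun x => p (x - y)) x, gradient ψ x⟫ = -∫ x, p (x - y) * (Δ ψ) x := by
  haveI : CompleteSpace E := FiniteDimensional.complete ℝ E
  have hpy : ContDiff ℝ 1 (fun x => p (x - y)) := hp.comp (contDiff_id.sub contDiff_const)
  have hg1 : ContDiff ℝ 1 (gradient ψ) :=
    (InnerProductSpace.toDual ℝ E).symm.contDiff.comp (hψ.fderiv_right (m := 1) le_rfl)
  have hgc : HasCompactSupport (gradient ψ) :=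
    (hψc.fderiv (𝕜 := ℝ)).comp_left (g := (InnerProductSpace.toDual ℝ E).symm) (map_zero _)
  rw [integral_inner_gradient_eq_neg_integral_mul_divergence hpy hg1 hgc]
  congr 1
  refine integral_congr_ae (Eventually.of_forall fun x => ?_)
  simp only [divergence_gradient hψ]

end IBP

section LaplacianDecay

variable [FiniteDimensional ℝ E] [MeasurableSpace E] [BorelSpace E]
variable {F : Type*} [NormedAddCommGroup F] [NormedSpace ℝ F] [CompleteSpace F]

/-- **Decay of the Laplacian of the heat flow of `L¹` data**: there is `C = C(E)` with
`‖Δ e^{sΔ} g (x)‖ ≤ C s^{-(d/2+1)} ‖g‖₁` for all `s > 0` (two derivatives gain `s⁻¹` over the `L¹–L^∞`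
bound; the kernel `(‖z‖²/(4s²) - d/(2s)) G_s(z)` of `Δe^{sΔ}` is `O(s^{-d/2-1})` uniformly in `z`).
Giga–Giga–Saal 2010, §1.1.3. [folklore] -/
theorem exists_norm_laplacian_heatExtension_le :
    ∃ C : ℝ, 0 < C ∧ ∀ {g : E → F}, Integrable g → ∀ {s : ℝ}, 0 < s → ∀ x : E,
      ‖(Δ (UnboundedOperators.heatExtension g s)) x‖ ≤
        C * s ^ (-((Module.finrank ℝ E : ℝ) / 2 + 1)) * ∫ y, ‖g y‖ := by
  set d : ℝ := (Module.finrank ℝ E : ℝ) with hd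
  have hd0 : 0 ≤ d := Nat.cast_nonneg _
  obtain ⟨C₀, hC₀, hG₀⟩ := exists_heatKernel_le_rpow (E := E) 0
  obtain ⟨C₁, hC₁, hG₁⟩ := exists_heatKernel_le_rpow (E := E) 1
  refine ⟨C₁ / 4 + d * C₀ / 2 + 1, by positivity, fun {g} hg {s} hs x => ?_⟩
  set w : E → ℝ := fun z => (‖z‖ ^ 2 / (4 * s ^ 2) - d / (2 * s)) * UnboundedOperators.heatKernel s z
    with hw
  -- the kernel bound
  have hwle : ∀ z, |w z| ≤ (C₁ / 4 + d * C₀ / 2 + 1) * s ^ (-(d / 2 + 1)) := by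
    intro z
    set ρ : ℝ := s + ‖z‖ ^ 2 with hρ
    have hρ0 : 0 < ρ := by positivity
    have hGpos := UnboundedOperators.heatKernel_pos hs z
    have h0 : UnboundedOperators.heatKernel s z ≤ C₀ * s ^ (-(d / 2)) := by
      have := hG₀ hs z
      rwa [neg_zero, Real.rpow_zero, mul_one, zero_sub] at this
    have h1 : ‖z‖ ^ 2 * UnboundedOperators.heatKernel s z ≤ C₁ * s ^ (1 - d / 2) := by
      have hz : ‖z‖ ^ 2 ≤ ρ := by rw [hρ]; linarith
      calc ‖z‖ ^ 2 * UnboundedOperators.heatKernel s z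
          ≤ ρ * (C₁ * s ^ (1 - d / 2) * ρ ^ (-(1 : ℝ))) :=
            mul_le_mul hz (hG₁ hs z) hGpos.le hρ0.le
        _ = C₁ * s ^ (1 - d / 2) * (ρ * ρ ^ (-(1 : ℝ))) := by ring
        _ = C₁ * s ^ (1 - d / 2) := by rw [Real.rpow_neg_one, mul_inv_cancel₀ hρ0.ne', mul_one]
    have hs1 : s ^ (1 - d / 2) / s ^ 2 = s ^ (-(d / 2 + 1)) := by
      rw [← Real.rpow_natCast, ← Real.rpow_sub hs]; congr 1; push_cast; ring
    have hs0 : s ^ (-(d / 2)) / s = s ^ (-(d / 2 + 1)) := by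
      rw [show s ^ (-(d / 2)) / s = s ^ (-(d / 2)) / s ^ (1 : ℝ) by rw [Real.rpow_one],
        ← Real.rpow_sub hs]
      congr 1; ring
    calc |w z| ≤ |‖z‖ ^ 2 / (4 * s ^ 2) * UnboundedOperators.heatKernel s z| +
          |d / (2 * s) * UnboundedOperators.heatKernel s z| := by
          rw [hw]; simp only; rw [sub_mul]; exact abs_sub _ _
      _ = (‖z‖ ^ 2 * UnboundedOperators.heatKernel s z) / (4 * s ^ 2) +
          d / 2 * (UnboundedOperators.heatKernel s z / s) := by
          rw [abs_of_nonneg (by positivity), abs_of_nonneg (by positivity)]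
          field_simp
      _ ≤ (C₁ * s ^ (1 - d / 2)) / (4 * s ^ 2) + d / 2 * (C₀ * s ^ (-(d / 2)) / s) := by
          gcongr
      _ = C₁ / 4 * (s ^ (1 - d / 2) / s ^ 2) + d * C₀ / 2 * (s ^ (-(d / 2)) / s) := by ring
      _ = (C₁ / 4 + d * C₀ / 2) * s ^ (-(d / 2 + 1)) := by rw [hs1, hs0]; ring
      _ ≤ (C₁ / 4 + d * C₀ / 2 + 1) * s ^ (-(d / 2 + 1)) :=
          mul_le_mul_of_nonneg_right (by linarith) (Real.rpow_nonneg hs.le _)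
  rw [UnboundedOperators.laplacian_heatExtension_eq_integral hs (memLp_one_iff_integrable.2 hg)
    le_rfl x]
  have hint : Integrable (fun y => (C₁ / 4 + d * C₀ / 2 + 1) * s ^ (-(d / 2 + 1)) * ‖g y‖) :=
    hg.norm.const_mul _
  calc ‖∫ y, w (x - y) • g y‖ ≤ ∫ y, (C₁ / 4 + d * C₀ / 2 + 1) * s ^ (-(d / 2 + 1)) * ‖g y‖ := by
        refine norm_integral_le_of_norm_le hint (Eventually.of_forall fun y => ?_)
        rw [norm_smul, Real.norm_eq_abs]
        exact mul_le_mul_of_nonneg_right (hwle _) (norm_nonneg _)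
    _ = (C₁ / 4 + d * C₀ / 2 + 1) * s ^ (-(d / 2 + 1)) * ∫ y, ‖g y‖ := integral_const_mul _ _

omit [CompleteSpace F] in
/-- The caloric extension of `L¹` data tends to zero pointwise as `σ → ∞` (positive dimension;
norm form of `tendsto_enorm_heatExtension_atTop`). [folklore] -/
theorem tendsto_heatExtension_atTop_of_integrable {g : E → F} (hg : Integrable g)
    (hn : 0 < Module.finrank ℝ E) (x : E) :
    Tendsto (fun σ : ℝ => UnboundedOperators.heatExtension g σ x) atTop (𝓝 0) := by
  have h := UnboundedOperators.tendsto_enorm_heatExtension_atTop (memLp_one_iff_integrable.2 hg)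
    le_rfl ENNReal.one_ne_top hn x
  rw [tendsto_zero_iff_norm_tendsto_zero]
  have h' := (ENNReal.tendsto_toReal ENNReal.zero_ne_top).comp h
  simpa [Function.comp_def] using h'

/-- **The heat flow from infinity**: for `g ∈ L¹`, `σ > 0` and positive dimension,
`s ↦ Δ e^{sΔ} g (x)` is integrable on `(σ, ∞)` and `∫_σ^∞ Δ e^{sΔ} g (x) ds = -e^{σΔ} g (x)`
(the heat equation `∂_s e^{sΔ}g = Δ e^{sΔ}g` integrated on `[σ, S]` and `e^{SΔ}g(x) → 0`).
Evans, *PDE*, §2.3.1, Thm. 1. [folklore] -/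
theorem integral_Ioi_laplacian_heatExtension {g : E → F} (hg : Integrable g)
    (hn : 0 < Module.finrank ℝ E) {σ : ℝ} (hσ : 0 < σ) (x : E) :
    IntegrableOn (fun s => (Δ (UnboundedOperators.heatExtension g s)) x) (Ioi σ) ∧
      ∫ s in Ioi σ, (Δ (UnboundedOperators.heatExtension g s)) x =
        -UnboundedOperators.heatExtension g σ x := by
  set d : ℝ := (Module.finrank ℝ E : ℝ) with hd
  have hg1 : MemLp g 1 volume := memLp_one_iff_integrable.2 hg
  obtain ⟨C, hC, hΔ⟩ := exists_norm_laplacian_heatExtension_le (E := E) (F := F)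
  -- integrability on the half-line
  have hr : -(d / 2 + 1) < -1 := by
    have : (0 : ℝ) < d := by rw [hd]; exact_mod_cast hn
    linarith
  have hdom : IntegrableOn (fun s : ℝ => C * s ^ (-(d / 2 + 1)) * ∫ y, ‖g y‖) (Ioi σ) :=
    ((integrableOn_Ioi_rpow_of_lt hr hσ).const_mul C).mul_const _
  have hmeas : AEStronglyMeasurable (fun s => (Δ (UnboundedOperators.heatExtension g s)) x)
      (volume.restrict (Ioi σ)) :=
    ((UnboundedOperators.continuousOn_laplacian_heatExtension_time hg1 le_rfl x).mono
      (Ioi_subset_Ioi hσ.le)).aestronglyMeasurable measurableSet_Ioi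
  have hint : IntegrableOn (fun s => (Δ (UnboundedOperators.heatExtension g s)) x) (Ioi σ) :=
    hdom.mono' hmeas ((ae_restrict_iff' measurableSet_Ioi).2 (Eventually.of_forall fun s hs =>
      hΔ hg (hσ.trans hs) x))
  refine ⟨hint, ?_⟩
  -- the limit of the interval integrals
  have hlim1 : Tendsto (fun S => ∫ s in σ..S, (Δ (UnboundedOperators.heatExtension g s)) x) atTop
      (𝓝 (∫ s in Ioi σ, (Δ (UnboundedOperators.heatExtension g s)) x)) :=
    intervalIntegral_tendsto_integral_Ioi σ hint tendsto_id
  have hlim2 : Tendsto (fun S => ∫ s in σ..S, (Δ (UnboundedOperators.heatExtension g s)) x) atTop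
      (𝓝 (0 - UnboundedOperators.heatExtension g σ x)) := by
    have heq : (fun S => ∫ s in σ..S, (Δ (UnboundedOperators.heatExtension g s)) x) =ᶠ[atTop]
        fun S => UnboundedOperators.heatExtension g S x - UnboundedOperators.heatExtension g σ x := by
      filter_upwards [eventually_ge_atTop σ] with S hS
      exact (UnboundedOperators.heatExtension_sub_eq_integral_laplacian hg1 le_rfl hσ hS x).symm
    rw [tendsto_congr' heq]
    exact (tendsto_heatExtension_atTop_of_integrable hg hn x).sub_const _
  rw [tendsto_nhds_unique hlim1 hlim2, zero_sub]

end LaplacianDecay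

/-! ## The kernel against test fields: the adjoint identity and the annihilation of gradients -/

section Pairing

variable [FiniteDimensional ℝ E] [MeasurableSpace E] [BorelSpace E]

omit [MeasurableSpace E] [BorelSpace E] in
/-- The Laplacian of a real test function is a test function (`Δ = Σᵢ ∂ᵢ∂ᵢ` over an orthonormal
frame). [folklore] -/
theorem isTestFunctionOn_laplacian {ψ : E → ℝ} (hψ : FunctionSpaces.IsTestFunctionOn (⊤ : Opens E) ψ) :
    FunctionSpaces.IsTestFunctionOn (⊤ : Opens E) (Δ ψ) := by
  set b := stdOrthonormalBasis ℝ E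
  have hψ2 : ContDiff ℝ 2 ψ := contDiff_infty.1 hψ.contDiff 2
  have hΔ_eq : Δ ψ = fun y => ∑ i, fderiv ℝ (fun z => fderiv ℝ ψ z (b i)) y (b i) :=
    funext fun y => laplacian_eq_sum_fderiv_fderiv b hψ2 y
  refine ⟨?_, ?_, by simp⟩
  · rw [hΔ_eq]
    exact ContDiff.sum fun i _ => ((hψ.fderiv_apply_const (b i)).fderiv_apply_const (b i)).contDiff
  · exact HasCompactSupport.intro hψ.hasCompactSupport fun x hx =>
      laplacian_eq_zero_of_notMem_tsupport hx

omit [FiniteDimensional ℝ E] [MeasurableSpace E] [BorelSpace E] in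
/-- The gradient of a shifted function: `∇[p(· - y)](x) = ∇p(x - y)`. [folklore] -/
theorem gradient_comp_sub [CompleteSpace E] (p : E → ℝ) (y x : E) :
    gradient (fun x => p (x - y)) x = gradient p (x - y) := by
  unfold gradient
  rw [fderiv_comp_sub]

/-- **The kernel against a test field, split along its gradient structure** (Koch–Tataru 2001, §2,
(8), and §3, (11)): for `σ > 0` and a continuous compactly supported field `w`,
`∫ ⟪K(σ, x - y)[a, b], w(x)⟫ dx = ∫ (D_aG_σ)(x - y) ⟪b, w(x)⟫ dx + ∫_σ^∞ ∫ ⟪Θ_s(x - y)[a, b], w(x)⟫ dx ds`,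
the exchange of the `s`- and `x`-integrations being justified by the uniform decay
`‖Θ_s‖ ≤ C s^{-(d+3)/2} ‖a‖ ‖b‖` (Fubini). [cite: KochTataruAdvMath2001, §2 (8) and §3 (11)] -/
theorem integral_inner_oseenKernel_comp_sub {σ : ℝ} (hσ : 0 < σ) (y a b : E) {w : E → E}
    (hw : Continuous w) (hwc : HasCompactSupport w) :
    ∫ x, ⟪oseenKernel σ (x - y) a b, w x⟫ =
      (∫ x, fderiv ℝ (UnboundedOperators.heatKernel σ) (x - y) a * ⟪b, w x⟫) +
        ∫ s in Ioi σ, ∫ x, ⟪oseenIntegrand s (x - y) a b, w x⟫ := by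
  obtain ⟨M, -, hM⟩ := exists_integrableOn_oseenIntegrand (E := E)
  obtain ⟨C, hC, hΘ⟩ := exists_norm_oseenIntegrand_le (E := E)
  set r : ℝ := -(((Module.finrank ℝ E : ℝ) + 3) / 2) with hr
  have hr1 : r < -1 := by
    rw [hr]
    have : (0 : ℝ) ≤ Module.finrank ℝ E := Nat.cast_nonneg _
    linarith
  set f : E → ℝ → ℝ := fun x s => ⟪oseenIntegrand s (x - y) a b, w x⟫ with hf
  -- integrability on the product `E × (σ, ∞)`
  have hmeas : Measurable (uncurry f) := by
    have h1 : Measurable (fun p : E × ℝ => oseenIntegrand p.2 (p.1 - y) a b) :=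
      (measurable_oseenIntegrand a b).comp (measurable_snd.prodMk (measurable_fst.sub measurable_const))
    exact h1.inner (hw.measurable.comp measurable_fst)
  have hprod : Integrable (uncurry f) ((volume : Measure E).prod ((volume : Measure ℝ).restrict (Ioi σ))) := by
    have hwi : Integrable (fun x => ‖w x‖) (volume : Measure E) :=
      (hw.norm).integrable_of_hasCompactSupport hwc.norm
    have hpow : Integrable (fun s : ℝ => C * s ^ r * ‖a‖ * ‖b‖) ((volume : Measure ℝ).restrict (Ioi σ)) :=
      (((integrableOn_Ioi_rpow_of_lt hr1 hσ).const_mul C).mul_const _).mul_const _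
    have hg := hwi.mul_prod hpow
    have hmem : ∀ᵐ p ∂((volume : Measure E).prod ((volume : Measure ℝ).restrict (Ioi σ))), p.2 ∈ Ioi σ := by
      have h := ae_restrict_mem (μ := (volume : Measure E).prod (volume : Measure ℝ))
        (MeasurableSet.univ.prod (measurableSet_Ioi (a := σ)))
      rw [← Measure.prod_restrict, Measure.restrict_univ] at h
      filter_upwards [h] with p hp using hp.2
    refine hg.mono' hmeas.aestronglyMeasurable ?_
    filter_upwards [hmem] with p hp
    rw [Real.norm_eq_abs]
    calc |uncurry f p| = |⟪oseenIntegrand p.2 (p.1 - y) a b, w p.1⟫| := rfl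
      _ ≤ ‖oseenIntegrand p.2 (p.1 - y) a b‖ * ‖w p.1‖ := abs_real_inner_le_norm _ _
      _ ≤ (C * p.2 ^ r * ‖a‖ * ‖b‖) * ‖w p.1‖ := by
          gcongr
          exact hΘ (hσ.trans hp) _ _ _
      _ = ‖w p.1‖ * (C * p.2 ^ r * ‖a‖ * ‖b‖) := mul_comm _ _
  -- pointwise splitting of the integrand
  have hinner : ∀ x, ⟪∫ s in Ioi σ, oseenIntegrand s (x - y) a b, w x⟫ = ∫ s in Ioi σ, f x s := by
    intro x
    rw [real_inner_comm, ← integral_inner (hM hσ (x - y) a b).1 (w x)]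
    exact integral_congr_ae (Eventually.of_forall fun s => real_inner_comm _ _)
  have hpt : ∀ x, ⟪oseenKernel σ (x - y) a b, w x⟫ =
      fderiv ℝ (UnboundedOperators.heatKernel σ) (x - y) a * ⟪b, w x⟫ + ∫ s in Ioi σ, f x s := by
    intro x
    rw [oseenKernel_eq_fderiv_smul_add_integral hσ, inner_add_left, real_inner_smul_left, hinner]
  -- integrability of the two pieces
  have hI1 : Integrable (fun x => fderiv ℝ (UnboundedOperators.heatKernel σ) (x - y) a * ⟪b, w x⟫) := by
    refine Continuous.integrable_of_hasCompactSupport ?_ ?_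
    · exact ((UnboundedOperators.continuous_fderiv_heatKernel_apply σ a).comp
        (continuous_id.sub continuous_const)).mul (continuous_const.inner hw)
    · exact (hwc.comp_left (g := fun v => ⟪b, v⟫) (inner_zero_right _)).mul_left
  have hI2 : Integrable (fun x => ∫ s in Ioi σ, f x s) := hprod.integral_prod_left
  calc ∫ x, ⟪oseenKernel σ (x - y) a b, w x⟫
      = ∫ x, (fderiv ℝ (UnboundedOperators.heatKernel σ) (x - y) a * ⟪b, w x⟫ + ∫ s in Ioi σ, f x s) :=
        integral_congr_ae (Eventually.of_forall hpt)
    _ = (∫ x, fderiv ℝ (UnboundedOperators.heatKernel σ) (x - y) a * ⟪b, w x⟫) +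
          ∫ x, ∫ s in Ioi σ, f x s := integral_add hI1 hI2
    _ = _ := by rw [integral_integral_swap hprod]

/-- **The projector part pairs to zero with divergence-free fields**: for every `s`, the
`x`-pairing of `Θ_s(· - y)[a, b] = ∇(D_aD_bG_s)(· - y)` with a compactly supported divergence-free
`C¹` field vanishes (a gradient against a solenoidal field; Koch–Tataru 2001, §2, (8): the
projector part of the kernel of `Π∇S(t)` is a gradient in `z`). [cite: KochTataruAdvMath2001, §2 (8)] -/
theorem integral_inner_oseenIntegrand_comp_sub_eq_zero (s : ℝ) (y a b : E) {φ : E → E}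
    (hφ : ContDiff ℝ 1 φ) (hφc : HasCompactSupport φ) (hdiv : VectorCalculus.IsDivFree φ) :
    ∫ x, ⟪oseenIntegrand s (x - y) a b, φ x⟫ = 0 := by
  haveI : CompleteSpace E := FiniteDimensional.complete ℝ E
  have hgrad : ∀ x, gradient (fun x => heatKernelD2 s a b (x - y)) x = oseenIntegrand s (x - y) a b :=
    fun x => by rw [gradient_comp_sub, gradient_heatKernelD2]
  simp_rw [← hgrad]
  exact integral_inner_gradient_comp_sub_eq_zero (contDiff_heatKernelD2 s a b) hφ hφc hdiv y

/-- **The adjoint identity of the Oseen–Koch–Tataru kernel against divergence-free tests**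
(Koch–Tataru 2001, §3, (11) tested; Lemarié-Rieusset 2016, Thm. 6.1, (6.12) ⇒ (6.11): the kernel
of `e^{σΔ}Π∇·` paired with a divergence-free test `φ`, on which `Π` acts as the identity): for
`σ > 0`, `y, a, b ∈ E` and `φ ∈ C_c^∞(E; E)` with `div φ = 0`,
`∫ ⟪K(σ, x - y)[a, b], φ(x)⟫ dx = -⟪b, D(e^{σΔ}φ)(y) a⟫`.
Proof: in `K = (D_aG_σ) b + ∫_σ^∞ ∇(D_aD_bG_s) ds` the second part pairs to `0` with `φ`
(a gradient against a divergence-free field), and the first gives, after one integration by parts and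
by evenness of `G_σ`, `-∫ G_σ(y - x) ⟪b, D_aφ(x)⟫ dx = -⟪b, D_a(e^{σΔ}φ)(y)⟫`. [cite: LemarieRieusset2016, Thm. 6.1 ((6.12) ⇒ (6.11)); KochTataruAdvMath2001 §3 (11)] -/
theorem integral_inner_oseenKernel_comp_sub_of_isDivFree {σ : ℝ} (hσ : 0 < σ) (y a b : E)
    {φ : E → E} (hφ : FunctionSpaces.IsTestFunctionOn (⊤ : Opens E) φ) (hdiv : VectorCalculus.IsDivFree φ) :
    ∫ x, ⟪oseenKernel σ (x - y) a b, φ x⟫ =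
      -⟪b, fderiv ℝ (UnboundedOperators.heatExtension φ σ) y a⟫ := by
  haveI : CompleteSpace E := FiniteDimensional.complete ℝ E
  have hφ1 : ContDiff ℝ 1 φ := hφ.contDiff.of_le (by exact_mod_cast le_top)
  have hφc : HasCompactSupport φ := hφ.hasCompactSupport
  rw [integral_inner_oseenKernel_comp_sub hσ y a b hφ.contDiff.continuous hφc]
  -- the projector part pairs to zero
  have hT2 : ∫ s in Ioi σ, ∫ x, ⟪oseenIntegrand s (x - y) a b, φ x⟫ = 0 := by
    simp [integral_inner_oseenIntegrand_comp_sub_eq_zero _ y a b hφ1 hφc hdiv]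
  -- the heat part
  have hT1 : ∫ x, fderiv ℝ (UnboundedOperators.heatKernel σ) (x - y) a * ⟪b, φ x⟫ =
      -⟪b, fderiv ℝ (UnboundedOperators.heatExtension φ σ) y a⟫ := by
    have hbφ1 : ContDiff ℝ 1 (fun x => ⟪b, φ x⟫) := contDiff_const.inner ℝ hφ1
    have hbφc : HasCompactSupport (fun x => ⟪b, φ x⟫) :=
      hφc.comp_left (g := fun v => ⟪b, v⟫) (inner_zero_right _)
    rw [integral_fderiv_comp_sub_mul (contDiff_heatKernel_space σ) hbφ1 hbφc y a]
    congr 1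
    have hD : ∀ x, fderiv ℝ (fun x => ⟪b, φ x⟫) x a = ⟪b, fderiv ℝ φ x a⟫ := fun x =>
      fderiv_inner_const_left_apply (hφ1.differentiable one_ne_zero) b x a
    simp_rw [hD]
    have hint : Integrable (fun x => UnboundedOperators.heatKernel σ (y - x) • fderiv ℝ φ x a) :=
      (((UnboundedOperators.continuous_heatKernel σ).comp (continuous_const.sub continuous_id)).smul
        ((hφ1.continuous_fderiv one_ne_zero).clm_apply continuous_const)).integrable_of_hasCompactSupport
        (hφc.fderiv_apply (𝕜 := ℝ) a).smul_left
    rw [UnboundedOperators.fderiv_heatExtension_apply_of_hasCompactSupport hφ1 hφc σ y a,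
      UnboundedOperators.heatExtension_eq_integral_sub, ← integral_inner hint b]
    refine integral_congr_ae (Eventually.of_forall fun x => ?_)
    beta_reduce
    rw [real_inner_smul_right, ← neg_sub y x, UnboundedOperators.heatKernel_neg]
  rw [hT1, hT2, add_zero]

/-- **The Oseen–Koch–Tataru kernel is divergence free in `z`** (Koch–Tataru 2001, §2, (5)–(8):
`div_z K(σ, z)[a, b] = 0`, since `Δ(Δ⁻¹G_σ) = G_σ`), in tested form: for `σ > 0`, `y, a, b ∈ E`
and every real test function `ψ`, `∫ ⟪K(σ, x - y)[a, b], ∇ψ(x)⟫ dx = 0`.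
Proof: with `χ = D_aD_bψ`, the heat part gives `-e^{σΔ}χ(y)` (one integration by parts), while
the projector part gives `∫_σ^∞ (-∫ D_aD_bG_s(x-y) Δψ(x) dx) ds = -∫_σ^∞ Δ e^{sΔ}χ(y) ds = +e^{σΔ}χ(y)`
(two more integrations by parts, `∂_a Δ = Δ ∂_a`, the heat equation and `e^{sΔ}χ(y) → 0` as
`s → ∞`). [cite: KochTataruAdvMath2001, §2 (5)–(8)] -/
theorem integral_inner_oseenKernel_comp_sub_gradient {σ : ℝ} (hσ : 0 < σ) (y a b : E)
    {ψ : E → ℝ} (hψ : FunctionSpaces.IsTestFunctionOn (⊤ : Opens E) ψ) :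
    ∫ x, ⟪oseenKernel σ (x - y) a b, gradient ψ x⟫ = 0 := by
  haveI : CompleteSpace E := FiniteDimensional.complete ℝ E
  -- dimension zero: the kernel vanishes identically
  rcases Nat.eq_zero_or_pos (Module.finrank ℝ E) with hd0 | hn
  · haveI : Subsingleton E := Module.finrank_zero_iff.1 hd0
    have h0 : ∀ x : E, x - y = 0 := fun x => Subsingleton.elim _ _
    simp [h0]
  -- smoothness bookkeeping
  have hψ1 : ContDiff ℝ 1 ψ := hψ.contDiff.of_le (by exact_mod_cast le_top)
  have hψ2 : ContDiff ℝ 2 ψ := contDiff_infty.1 hψ.contDiff 2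
  have hψ3 : ContDiff ℝ 3 ψ := contDiff_infty.1 hψ.contDiff 3
  have hψc : HasCompactSupport ψ := hψ.hasCompactSupport
  set χ : E → ℝ := fun x => fderiv ℝ (fun w => fderiv ℝ ψ w b) x a with hχ_def
  have hχ : FunctionSpaces.IsTestFunctionOn (⊤ : Opens E) χ :=
    (hψ.fderiv_apply_const b).fderiv_apply_const a
  have hχ2 : ContDiff ℝ 2 χ := contDiff_infty.1 hχ.contDiff 2
  have hχc : HasCompactSupport χ := hχ.hasCompactSupport
  have hχint : Integrable χ := hχ.contDiff.continuous.integrable_of_hasCompactSupport hχc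
  have hΔψ : FunctionSpaces.IsTestFunctionOn (⊤ : Opens E) (Δ ψ) := isTestFunctionOn_laplacian hψ
  have hΔψ1 : ContDiff ℝ 1 (Δ ψ) := hΔψ.contDiff.of_le (by exact_mod_cast le_top)
  have hΔa : FunctionSpaces.IsTestFunctionOn (⊤ : Opens E) (fun x => fderiv ℝ (Δ ψ) x a) :=
    hΔψ.fderiv_apply_const a
  have hΔa1 : ContDiff ℝ 1 (fun x => fderiv ℝ (Δ ψ) x a) := hΔa.contDiff.of_le (by exact_mod_cast le_top)
  -- the gradient of `ψ` is a continuous compactly supported field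
  have hgc : Continuous (gradient ψ) := continuous_gradient_of_contDiff hψ1
  have hgs : HasCompactSupport (gradient ψ) :=
    (hψc.fderiv (𝕜 := ℝ)).comp_left (g := (InnerProductSpace.toDual ℝ E).symm) (map_zero _)
  rw [integral_inner_oseenKernel_comp_sub hσ y a b hgc hgs]
  -- the heat part: `-e^{σΔ}χ(y)`
  have hT1 : ∫ x, fderiv ℝ (UnboundedOperators.heatKernel σ) (x - y) a * ⟪b, gradient ψ x⟫ =
      -UnboundedOperators.heatExtension χ σ y := by
    simp_rw [inner_gradient_eq_fderiv_apply]
    have hψb1 : ContDiff ℝ 1 (fun x => fderiv ℝ ψ x b) :=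
      (hψ.fderiv_apply_const b).contDiff.of_le (by exact_mod_cast le_top)
    rw [integral_fderiv_comp_sub_mul (contDiff_heatKernel_space σ) hψb1
      (hψ.fderiv_apply_const b).hasCompactSupport y a, UnboundedOperators.heatExtension_eq_integral_sub]
    congr 1
    refine integral_congr_ae (Eventually.of_forall fun x => ?_)
    simp only [smul_eq_mul, hχ_def]
    rw [← UnboundedOperators.heatKernel_neg, neg_sub]
  -- the projector part: `+e^{σΔ}χ(y)`
  have hgrad : ∀ s x, gradient (fun x => heatKernelD2 s a b (x - y)) x = oseenIntegrand s (x - y) a b :=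
    fun s x => by rw [gradient_comp_sub, gradient_heatKernelD2]
  -- `D_b D_a Δψ = Δχ`
  have hDD : ∀ x, fderiv ℝ (fun x => fderiv ℝ (Δ ψ) x a) x b = (Δ χ) x := by
    intro x
    have h1 : (fun x => fderiv ℝ (Δ ψ) x a) = Δ (fun w => fderiv ℝ ψ w a) :=
      funext fun x => fderiv_laplacian_apply hψ3 x a
    have hψa3 : ContDiff ℝ 3 (fun w => fderiv ℝ ψ w a) :=
      contDiff_infty.1 (hψ.fderiv_apply_const a).contDiff 3
    rw [h1, fderiv_laplacian_apply hψa3 x b]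
    have h2 : (fun w => fderiv ℝ (fun w' => fderiv ℝ ψ w' a) w b) = χ :=
      funext fun w => fderiv_fderiv_apply_comm hψ2 w b a
    rw [h2]
  have hinner : ∀ s ∈ Ioi σ, ∫ x, ⟪oseenIntegrand s (x - y) a b, gradient ψ x⟫ =
      -UnboundedOperators.heatExtension (Δ χ) s y := by
    intro s hs
    calc ∫ x, ⟪oseenIntegrand s (x - y) a b, gradient ψ x⟫
        = ∫ x, ⟪gradient (fun x => heatKernelD2 s a b (x - y)) x, gradient ψ x⟫ := by
          simp_rw [hgrad]
      _ = -∫ x, heatKernelD2 s a b (x - y) * (Δ ψ) x :=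
          integral_inner_gradient_comp_sub_gradient (contDiff_heatKernelD2 s a b) hψ2 hψc y
      _ = -∫ x, fderiv ℝ (fun w => fderiv ℝ (UnboundedOperators.heatKernel s) w b) (x - y) a * (Δ ψ) x := by
          simp_rw [fderiv_fderiv_heatKernel_apply_eq_heatKernelD2]
      _ = ∫ x, fderiv ℝ (UnboundedOperators.heatKernel s) (x - y) b * fderiv ℝ (Δ ψ) x a := by
          rw [integral_fderiv_comp_sub_mul (contDiff_fderiv_heatKernel_apply s b) hΔψ1
            hΔψ.hasCompactSupport y a, neg_neg]
      _ = -∫ x, UnboundedOperators.heatKernel s (x - y) * (Δ χ) x := by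
          rw [integral_fderiv_comp_sub_mul (contDiff_heatKernel_space s) hΔa1 hΔa.hasCompactSupport y b]
          simp_rw [hDD]
      _ = -UnboundedOperators.heatExtension (Δ χ) s y := by
          rw [UnboundedOperators.heatExtension_eq_integral_sub]
          congr 1
          refine integral_congr_ae (Eventually.of_forall fun x => ?_)
          simp only [smul_eq_mul]
          rw [← UnboundedOperators.heatKernel_neg, neg_sub]
  have hT2 : ∫ s in Ioi σ, ∫ x, ⟪oseenIntegrand s (x - y) a b, gradient ψ x⟫ =
      UnboundedOperators.heatExtension χ σ y := by
    have hkey := (integral_Ioi_laplacian_heatExtension hχint hn hσ y).2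
    rw [setIntegral_congr_fun measurableSet_Ioi (fun s _ =>
      UnboundedOperators.laplacian_heatExtension_of_hasCompactSupport hχ2 hχc s y)] at hkey
    rw [setIntegral_congr_fun measurableSet_Ioi hinner, integral_neg, hkey, neg_neg]
  rw [hT1, hT2, neg_add_cancel]

end Pairing

/-! ## The bilinear Duhamel operator against test fields -/

section Bilinear

variable [FiniteDimensional ℝ E] [MeasurableSpace E] [BorelSpace E]

/-- **`B(u, v)(t)` for `t ≤ 0` is zero** (empty time interval; Koch–Tataru 2001, (11)). [cite: KochTataruAdvMath2001, (11)] -/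
theorem kochTataruBilinear_of_nonpos (u v : ℝ → E → E) {t : ℝ} (ht : t ≤ 0) (x : E) :
    kochTataruBilinear u v t x = 0 := by
  unfold kochTataruBilinear
  rw [Ioo_eq_empty (not_lt.2 ht), Measure.restrict_empty, integral_zero_measure]

/-- **Every slice of `B(u, v)` is strongly measurable** for fields measurable on `(0, ∞) × E`
(`B` only sees the space–time a.e. classes of its arguments, `kochTataruBilinear_congr_ae`, so one
may pass to strongly measurable representatives; `stronglyMeasurable_uncurry_kochTataruBilinear`). [folklore] -/
theorem stronglyMeasurable_kochTataruBilinear_slice {u v : ℝ → E → E}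
    (hu : AEStronglyMeasurable (uncurry u) ((volume : Measure (ℝ × E)).restrict (Ioi 0 ×ˢ univ)))
    (hv : AEStronglyMeasurable (uncurry v) ((volume : Measure (ℝ × E)).restrict (Ioi 0 ×ˢ univ)))
    (t : ℝ) : StronglyMeasurable (kochTataruBilinear u v t) := by
  set u' : ℝ → E → E := curry (hu.mk (uncurry u)) with hu'
  set v' : ℝ → E → E := curry (hv.mk (uncurry v)) with hv'
  have huu' : uncurry u =ᵐ[(volume : Measure (ℝ × E)).restrict (Ioi 0 ×ˢ univ)] uncurry u' := by
    rw [hu', uncurry_curry]; exact hu.ae_eq_mk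
  have hvv' : uncurry v =ᵐ[(volume : Measure (ℝ × E)).restrict (Ioi 0 ×ˢ univ)] uncurry v' := by
    rw [hv', uncurry_curry]; exact hv.ae_eq_mk
  have hsm : StronglyMeasurable (uncurry (kochTataruBilinear u' v')) := by
    refine stronglyMeasurable_uncurry_kochTataruBilinear ?_ ?_
    · rw [hu', uncurry_curry]; exact hu.stronglyMeasurable_mk
    · rw [hv', uncurry_curry]; exact hv.stronglyMeasurable_mk
  have heq : kochTataruBilinear u v t = fun x => uncurry (kochTataruBilinear u' v') (t, x) := by
    funext x
    exact kochTataruBilinear_congr_ae huu' hvv' x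
  rw [heq]
  exact hsm.comp_measurable (measurable_const.prodMk measurable_id)

/-- **Every positive-time slice of `B(u, v)` is bounded** for fields of finite Koch–Tataru norm:
`‖B(u,v)(t,x)‖ ≤ B` for some finite bound `B` (the proof takes `B = (C t^{-1/2} ‖u‖_X ‖v‖_X).toReal`
from `exists_enorm_kochTataruBilinear_le`, Koch–Tataru 2001, (12); users needing the rate should use
that lemma). [cite: KochTataruAdvMath2001, Lemma 3.2 (12)] -/
theorem exists_norm_kochTataruBilinear_le {u v : ℝ → E → E}
    (hu : AEStronglyMeasurable (uncurry u) ((volume : Measure (ℝ × E)).restrict (Ioi 0 ×ˢ univ)))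
    (hv : AEStronglyMeasurable (uncurry v) ((volume : Measure (ℝ × E)).restrict (Ioi 0 ×ˢ univ)))
    (huX : eKochTataruNorm u < ∞) (hvX : eKochTataruNorm v < ∞) {t : ℝ} (ht : 0 < t) :
    ∃ B : ℝ, 0 ≤ B ∧ ∀ x : E, ‖kochTataruBilinear u v t x‖ ≤ B := by
  obtain ⟨C, hC, h⟩ := exists_enorm_kochTataruBilinear_le (E := E)
  set M : ℝ≥0∞ := ENNReal.ofReal (C * t ^ (-(1 / 2 : ℝ))) * eKochTataruNorm u * eKochTataruNorm v with hM
  have hMtop : M ≠ ∞ := ENNReal.mul_ne_top (ENNReal.mul_ne_top ENNReal.ofReal_ne_top huX.ne) hvX.ne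
  refine ⟨M.toReal, ENNReal.toReal_nonneg, fun x => ?_⟩
  have hx := h hu hv ht x
  rw [← hM] at hx
  calc ‖kochTataruBilinear u v t x‖ = (‖kochTataruBilinear u v t x‖ₑ).toReal := by simp
    _ ≤ M.toReal := ENNReal.toReal_mono hMtop hx

/-- **Positive-time slices of `B(u, v)` pair integrably with continuous compactly supported
fields** (bounded measurable slice × continuous compactly supported field). [folklore] -/
theorem integrable_inner_kochTataruBilinear {u v : ℝ → E → E}
    (hu : AEStronglyMeasurable (uncurry u) ((volume : Measure (ℝ × E)).restrict (Ioi 0 ×ˢ univ)))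
    (hv : AEStronglyMeasurable (uncurry v) ((volume : Measure (ℝ × E)).restrict (Ioi 0 ×ˢ univ)))
    (huX : eKochTataruNorm u < ∞) (hvX : eKochTataruNorm v < ∞) {t : ℝ} (ht : 0 < t)
    {w : E → E} (hw : Continuous w) (hwc : HasCompactSupport w) :
    Integrable (fun x => ⟪kochTataruBilinear u v t x, w x⟫) := by
  obtain ⟨B, hB0, hB⟩ := exists_norm_kochTataruBilinear_le hu hv huX hvX ht
  have hwi : Integrable (fun x => B * ‖w x‖) := ((hw.norm).integrable_of_hasCompactSupport hwc.norm).const_mul B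
  refine hwi.mono' ?_ (Eventually.of_forall fun x => ?_)
  · exact ((stronglyMeasurable_kochTataruBilinear_slice hu hv t).measurable.inner hw.measurable)
      |>.aestronglyMeasurable
  · rw [Real.norm_eq_abs]
    calc |⟪kochTataruBilinear u v t x, w x⟫| ≤ ‖kochTataruBilinear u v t x‖ * ‖w x‖ :=
          abs_real_inner_le_norm _ _
      _ ≤ B * ‖w x‖ := by gcongr; exact hB x

/-- **`B(u, v)(t)` against a test field is the space–time integral of the tested kernel**
(Fubini over `E × ((0, t) × E)`, justified by the majorant of `KochTataruPointwise.lean`: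
`∫ |w(x)| ∫∫ |K(t-s, x-y)[u, v]| d(s,y) dx ≤ ‖w‖₁ C t^{-1/2} ‖u‖_X ‖v‖_X < ∞`): for `t > 0` and a
continuous compactly supported field `w`,
`∫ ⟪B(u,v)(t,x), w(x)⟫ dx = ∫_{(0,t) × E} (∫ ⟪K(t-s, x-y)[u(s,y), v(s,y)], w(x)⟫ dx) d(s,y)`
(Koch–Tataru 2001, §3, (11)–(12)). [cite: KochTataruAdvMath2001, §3 (11)–(12)] -/
theorem integral_inner_kochTataruBilinear_eq_setIntegral {u v : ℝ → E → E}
    (hu : AEStronglyMeasurable (uncurry u) ((volume : Measure (ℝ × E)).restrict (Ioi 0 ×ˢ univ)))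
    (hv : AEStronglyMeasurable (uncurry v) ((volume : Measure (ℝ × E)).restrict (Ioi 0 ×ˢ univ)))
    (huX : eKochTataruNorm u < ∞) (hvX : eKochTataruNorm v < ∞) {t : ℝ} (ht : 0 < t)
    {w : E → E} (hw : Continuous w) (hwc : HasCompactSupport w) :
    ∫ x, ⟪kochTataruBilinear u v t x, w x⟫ =
      ∫ p in Ioo 0 t ×ˢ univ, (∫ x, ⟪oseenKernel (t - p.1) (x - p.2) (u p.1 p.2) (v p.1 p.2), w x⟫)
        ∂(volume : Measure (ℝ × E)) := by
  set μ : Measure (ℝ × E) := (volume : Measure (ℝ × E)).restrict (Ioo 0 t ×ˢ univ) with hμ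
  set F : E → ℝ × E → E := fun x p => oseenKernel (t - p.1) (x - p.2) (u p.1 p.2) (v p.1 p.2) with hF
  -- `B(u,v)(t,x)` as an integral over `(0,t) × E`
  have hB : ∀ x, kochTataruBilinear u v t x = ∫ p, F x p ∂μ := by
    intro x
    have hint := integrable_oseenKernel_duhamel hu hv huX hvX ht x
    rw [FluidPDE.volume_restrict_prod_univ_eq_prod] at hint
    rw [hμ, FluidPDE.volume_restrict_prod_univ_eq_prod, integral_prod _ hint]
    rfl
  -- measurability of the integrand on `E × ((0,t) × E)`
  have hsub : Ioo (0 : ℝ) t ×ˢ (univ : Set E) ⊆ Ioi 0 ×ˢ univ := prod_mono Ioo_subset_Ioi_self subset_rfl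
  have hu' : AEStronglyMeasurable (fun p : ℝ × E => u p.1 p.2) μ :=
    hu.mono_measure (Measure.restrict_mono hsub le_rfl)
  have hv' : AEStronglyMeasurable (fun p : ℝ × E => v p.1 p.2) μ :=
    hv.mono_measure (Measure.restrict_mono hsub le_rfl)
  have hFm : AEStronglyMeasurable (uncurry fun x p => ⟪F x p, w x⟫) ((volume : Measure E).prod μ) := by
    have hK : AEMeasurable (fun q : E × (ℝ × E) => F q.1 q.2) ((volume : Measure E).prod μ) := by
      refine AEMeasurable.oseenKernel_comp ?_ ?_ ?_ ?_
      · exact (measurable_const.sub measurable_snd.fst).aemeasurable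
      · exact (measurable_fst.sub measurable_snd.snd).aemeasurable
      · exact (hu'.comp_snd (μ := (volume : Measure E))).aemeasurable
      · exact (hv'.comp_snd (μ := (volume : Measure E))).aemeasurable
    exact (hK.inner (hw.measurable.comp measurable_fst).aemeasurable).aestronglyMeasurable
  -- integrability on the product, by Tonelli and the majorant bound
  have hprod : Integrable (uncurry fun x p => ⟪F x p, w x⟫) ((volume : Measure E).prod μ) := by
    obtain ⟨C, hC, hmaj⟩ := exists_lintegral_enorm_oseenKernel_duhamel_le (E := E)
    set M : ℝ≥0∞ := ENNReal.ofReal (C * t ^ (-(1 / 2 : ℝ))) * eKochTataruNorm u * eKochTataruNorm v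
      with hM
    have hMtop : M < ∞ := ENNReal.mul_lt_top (ENNReal.mul_lt_top ENNReal.ofReal_lt_top huX) hvX
    refine ⟨hFm, ?_⟩
    rw [hasFiniteIntegral_iff_enorm, lintegral_prod _ hFm.enorm]
    have hwi : ∫⁻ x, ‖w x‖ₑ ∂(volume : Measure E) < ∞ := (hw.integrable_of_hasCompactSupport hwc).2
    calc ∫⁻ x, ∫⁻ p, ‖uncurry (fun x p => ⟪F x p, w x⟫) (x, p)‖ₑ ∂μ
        ≤ ∫⁻ x, ∫⁻ p, ‖F x p‖ₑ * ‖w x‖ₑ ∂μ := by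
          refine lintegral_mono fun x => lintegral_mono fun p => ?_
          simp only [uncurry_apply_pair]
          rw [← ofReal_norm, ← ofReal_norm, ← ofReal_norm, ← ENNReal.ofReal_mul (norm_nonneg _)]
          refine ENNReal.ofReal_le_ofReal ?_
          rw [Real.norm_eq_abs]
          exact abs_real_inner_le_norm _ _
      _ = ∫⁻ x, (∫⁻ p, ‖F x p‖ₑ ∂μ) * ‖w x‖ₑ := by
          refine lintegral_congr fun x => ?_
          rw [lintegral_mul_const' _ _ enorm_ne_top]
      _ ≤ ∫⁻ x, M * ‖w x‖ₑ := by
          refine lintegral_mono fun x => ?_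
          gcongr
          exact hmaj hu hv ht x
      _ = M * ∫⁻ x, ‖w x‖ₑ := lintegral_const_mul' _ _ hMtop.ne
      _ < ∞ := ENNReal.mul_lt_top hMtop hwi
  -- the inner product through the integral, then Fubini
  have hinner : ∀ x, ⟪kochTataruBilinear u v t x, w x⟫ = ∫ p, ⟪F x p, w x⟫ ∂μ := by
    intro x
    have hint := integrable_oseenKernel_duhamel hu hv huX hvX ht x
    rw [hB x, real_inner_comm, ← integral_inner hint (w x)]
    exact integral_congr_ae (Eventually.of_forall fun p => real_inner_comm _ _)
  calc ∫ x, ⟪kochTataruBilinear u v t x, w x⟫ = ∫ x, ∫ p, ⟪F x p, w x⟫ ∂μ :=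
        integral_congr_ae (Eventually.of_forall hinner)
    _ = ∫ p, (∫ x, ⟪F x p, w x⟫) ∂μ := integral_integral_swap hprod

/-- **`B(u, v)(t)` tested against a divergence-free field** (Koch–Tataru 2001, §3, (11);
Lemarié-Rieusset 2016, Thm. 6.1, (6.12) ⇒ (6.11)): for `t > 0` and `φ ∈ C_c^∞(E; E)` with
`div φ = 0`,
`∫ ⟪B(u,v)(t), φ⟫ = -∫₀ᵗ ∫ ⟪v(s,y), D(e^{(t-s)Δ}φ)(y) u(s,y)⟫ dy ds`
(the adjoint identity of the kernel inside the space–time integral; the iterated integral on the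
right is absolutely convergent). [cite: LemarieRieusset2016, Thm. 6.1 ((6.12) ⇒ (6.11)); KochTataruAdvMath2001 §3 (11)] -/
theorem integral_inner_kochTataruBilinear_of_isDivFree {u v : ℝ → E → E}
    (hu : AEStronglyMeasurable (uncurry u) ((volume : Measure (ℝ × E)).restrict (Ioi 0 ×ˢ univ)))
    (hv : AEStronglyMeasurable (uncurry v) ((volume : Measure (ℝ × E)).restrict (Ioi 0 ×ˢ univ)))
    (huX : eKochTataruNorm u < ∞) (hvX : eKochTataruNorm v < ∞) {t : ℝ} (ht : 0 < t)
    {φ : E → E} (hφ : FunctionSpaces.IsTestFunctionOn (⊤ : Opens E) φ) (hdiv : VectorCalculus.IsDivFree φ) :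
    Integrable (fun p : ℝ × E =>
        ⟪v p.1 p.2, fderiv ℝ (UnboundedOperators.heatExtension φ (t - p.1)) p.2 (u p.1 p.2)⟫)
        ((volume : Measure (ℝ × E)).restrict (Ioo 0 t ×ˢ univ)) ∧
      ∫ x, ⟪kochTataruBilinear u v t x, φ x⟫ =
        -∫ s in Ioo 0 t, ∫ y, ⟪v s y, fderiv ℝ (UnboundedOperators.heatExtension φ (t - s)) y (u s y)⟫ := by
  set μ : Measure (ℝ × E) := (volume : Measure (ℝ × E)).restrict (Ioo 0 t ×ˢ univ) with hμ
  set g : ℝ × E → ℝ := fun p =>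
    ⟪v p.1 p.2, fderiv ℝ (UnboundedOperators.heatExtension φ (t - p.1)) p.2 (u p.1 p.2)⟫ with hg
  have hφc := hφ.hasCompactSupport
  have hcont := hφ.contDiff.continuous
  -- the tested kernel on `(0,t) × E` is `-g`
  have hK : ∀ p ∈ Ioo (0 : ℝ) t ×ˢ (univ : Set E),
      ∫ x, ⟪oseenKernel (t - p.1) (x - p.2) (u p.1 p.2) (v p.1 p.2), φ x⟫ = -g p := by
    intro p hp
    rw [mem_prod] at hp
    exact integral_inner_oseenKernel_comp_sub_of_isDivFree (sub_pos.2 hp.1.2) p.2 _ _ hφ hdiv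
  -- integrability of `g`: it is (minus) the Fubini marginal of an integrable function
  have hmarg : Integrable (fun p : ℝ × E =>
      ∫ x, ⟪oseenKernel (t - p.1) (x - p.2) (u p.1 p.2) (v p.1 p.2), φ x⟫) μ := by
    -- re-run the product integrability of `integral_inner_kochTataruBilinear_eq_setIntegral`
    have h := integral_inner_kochTataruBilinear_eq_setIntegral hu hv huX hvX ht hcont hφc
    -- (the marginal is integrable by Fubini; we obtain it from the bounded-slice estimate instead)
    obtain ⟨C, hC, hmaj⟩ := exists_lintegral_enorm_oseenKernel_duhamel_le (E := E)
    clear h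
    set F : E → ℝ × E → E := fun x p => oseenKernel (t - p.1) (x - p.2) (u p.1 p.2) (v p.1 p.2) with hF
    have hsub : Ioo (0 : ℝ) t ×ˢ (univ : Set E) ⊆ Ioi 0 ×ˢ univ := prod_mono Ioo_subset_Ioi_self subset_rfl
    have hu' : AEStronglyMeasurable (fun p : ℝ × E => u p.1 p.2) μ :=
      hu.mono_measure (Measure.restrict_mono hsub le_rfl)
    have hv' : AEStronglyMeasurable (fun p : ℝ × E => v p.1 p.2) μ :=
      hv.mono_measure (Measure.restrict_mono hsub le_rfl)
    have hFm : AEStronglyMeasurable (uncurry fun x p => ⟪F x p, φ x⟫) ((volume : Measure E).prod μ) := by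
      have hK : AEMeasurable (fun q : E × (ℝ × E) => F q.1 q.2) ((volume : Measure E).prod μ) := by
        refine AEMeasurable.oseenKernel_comp ?_ ?_ ?_ ?_
        · exact (measurable_const.sub measurable_snd.fst).aemeasurable
        · exact (measurable_fst.sub measurable_snd.snd).aemeasurable
        · exact (hu'.comp_snd (μ := (volume : Measure E))).aemeasurable
        · exact (hv'.comp_snd (μ := (volume : Measure E))).aemeasurable
      exact (hK.inner (hcont.measurable.comp measurable_fst).aemeasurable).aestronglyMeasurable
    have hprod : Integrable (uncurry fun x p => ⟪F x p, φ x⟫) ((volume : Measure E).prod μ) := by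
      set M : ℝ≥0∞ := ENNReal.ofReal (C * t ^ (-(1 / 2 : ℝ))) * eKochTataruNorm u * eKochTataruNorm v
        with hM
      have hMtop : M < ∞ := ENNReal.mul_lt_top (ENNReal.mul_lt_top ENNReal.ofReal_lt_top huX) hvX
      refine ⟨hFm, ?_⟩
      rw [hasFiniteIntegral_iff_enorm, lintegral_prod _ hFm.enorm]
      have hwi : ∫⁻ x, ‖φ x‖ₑ ∂(volume : Measure E) < ∞ := (hcont.integrable_of_hasCompactSupport hφc).2
      calc ∫⁻ x, ∫⁻ p, ‖uncurry (fun x p => ⟪F x p, φ x⟫) (x, p)‖ₑ ∂μ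
          ≤ ∫⁻ x, ∫⁻ p, ‖F x p‖ₑ * ‖φ x‖ₑ ∂μ := by
            refine lintegral_mono fun x => lintegral_mono fun p => ?_
            simp only [uncurry_apply_pair]
            rw [← ofReal_norm, ← ofReal_norm, ← ofReal_norm, ← ENNReal.ofReal_mul (norm_nonneg _)]
            refine ENNReal.ofReal_le_ofReal ?_
            rw [Real.norm_eq_abs]
            exact abs_real_inner_le_norm _ _
        _ = ∫⁻ x, (∫⁻ p, ‖F x p‖ₑ ∂μ) * ‖φ x‖ₑ := by
            refine lintegral_congr fun x => ?_
            rw [lintegral_mul_const' _ _ enorm_ne_top]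
        _ ≤ ∫⁻ x, M * ‖φ x‖ₑ := by
            refine lintegral_mono fun x => ?_
            gcongr
            exact hmaj hu hv ht x
        _ = M * ∫⁻ x, ‖φ x‖ₑ := lintegral_const_mul' _ _ hMtop.ne
        _ < ∞ := ENNReal.mul_lt_top hMtop hwi
    exact hprod.integral_prod_right
  have hgi : Integrable g μ := by
    have hneg : Integrable (fun p => -∫ x, ⟪oseenKernel (t - p.1) (x - p.2) (u p.1 p.2) (v p.1 p.2), φ x⟫) μ :=
      hmarg.neg
    refine hneg.congr ?_
    filter_upwards [ae_restrict_mem (measurableSet_Ioo.prod MeasurableSet.univ)] with p hp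
    rw [hK p hp, neg_neg]
  refine ⟨hgi, ?_⟩
  rw [integral_inner_kochTataruBilinear_eq_setIntegral hu hv huX hvX ht hcont hφc,
    setIntegral_congr_fun (measurableSet_Ioo.prod MeasurableSet.univ) hK, integral_neg]
  congr 1
  have hgi' : Integrable g (((volume : Measure ℝ).restrict (Ioo 0 t)).prod (volume : Measure E)) := by
    rwa [hμ, FluidPDE.volume_restrict_prod_univ_eq_prod] at hgi
  rw [FluidPDE.volume_restrict_prod_univ_eq_prod, integral_prod _ hgi']

/-- **`B(u, u)(t)` tested in the duality form of the tree** (the nonlinear term of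
`Fluid.IsMildNSSolutionFrom 1 0 u₀ u t`): for `t > 0` and a divergence-free test field `φ`,
`∫ ⟪B(u,u)(t), φ⟫ = -∫₀ᵗ ∫ ⟪u(τ), (u(τ)·∇) e^{(t-τ)Δ}φ⟫ dτ`
(Koch–Tataru 2001, §3, (11); Lemarié-Rieusset 2016, Thm. 6.1, (6.12) ⇒ (6.11)). [cite: LemarieRieusset2016, Thm. 6.1 ((6.12) ⇒ (6.11)); KochTataruAdvMath2001 §3 (11)] -/
theorem integral_inner_kochTataruBilinear_eq_neg_intervalIntegral {u : ℝ → E → E}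
    (hu : AEStronglyMeasurable (uncurry u) ((volume : Measure (ℝ × E)).restrict (Ioi 0 ×ˢ univ)))
    (huX : eKochTataruNorm u < ∞) {t : ℝ} (ht : 0 < t)
    {φ : E → E} (hφ : FunctionSpaces.IsTestFunctionOn (⊤ : Opens E) φ) (hdiv : VectorCalculus.IsDivFree φ) :
    ∫ x, ⟪kochTataruBilinear u u t x, φ x⟫ =
      -∫ τ in 0..t, ∫ y, ⟪u τ y, convect (u τ) (heatTest 1 φ (t - τ)) y⟫ := by
  rw [(integral_inner_kochTataruBilinear_of_isDivFree hu hu huX huX ht hφ hdiv).2,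
    intervalIntegral.integral_of_le ht.le, integral_Ioc_eq_integral_Ioo]
  congr 1
  refine setIntegral_congr_fun measurableSet_Ioo fun τ hτ => ?_
  have hpos : 0 < t - τ := sub_pos.2 hτ.2
  simp only [convect_apply, heatTest_of_pos one_pos hpos, one_mul]

/-- **`B(u, v)(t)` is weakly divergence free** for every `t` (Koch–Tataru 2001, §2–§3: the kernel
of `V∇Π` is divergence free in `z`; tested form via `integral_inner_oseenKernel_comp_sub_gradient`
inside the space–time integral; for `t ≤ 0` the slice is zero). [cite: KochTataruAdvMath2001, §2 (5)–(8) and §3 (11)] -/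
theorem isWeaklyDivFree_kochTataruBilinear {u v : ℝ → E → E}
    (hu : AEStronglyMeasurable (uncurry u) ((volume : Measure (ℝ × E)).restrict (Ioi 0 ×ˢ univ)))
    (hv : AEStronglyMeasurable (uncurry v) ((volume : Measure (ℝ × E)).restrict (Ioi 0 ×ˢ univ)))
    (huX : eKochTataruNorm u < ∞) (hvX : eKochTataruNorm v < ∞) (t : ℝ) :
    IsWeaklyDivFree (kochTataruBilinear u v t) := by
  haveI : CompleteSpace E := FiniteDimensional.complete ℝ E
  intro θ hθ
  rcases le_or_gt t 0 with ht | ht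
  · have h0 : kochTataruBilinear u v t = 0 := funext fun x => kochTataruBilinear_of_nonpos u v ht x
    simp [h0]
  have hθ1 : ContDiff ℝ 1 θ := hθ.contDiff.of_le (by exact_mod_cast le_top)
  have hgc : Continuous (gradient θ) := continuous_gradient_of_contDiff hθ1
  have hgs : HasCompactSupport (gradient θ) :=
    (hθ.hasCompactSupport.fderiv (𝕜 := ℝ)).comp_left (g := (InnerProductSpace.toDual ℝ E).symm)
      (map_zero _)
  rw [integral_inner_kochTataruBilinear_eq_setIntegral hu hv huX hvX ht hgc hgs,
    setIntegral_congr_fun (measurableSet_Ioo.prod MeasurableSet.univ) (g := fun _ => 0)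
      (fun p hp => ?_)]
  · simp
  · rw [mem_prod] at hp
    exact integral_inner_oseenKernel_comp_sub_gradient (sub_pos.2 hp.1.2) p.2 _ _ hθ

end Bilinear
end Literature.Analysis.FluidPDE
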